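import Literature.NumberTheory.Sieve.DrappeauDispersionS1Reindex
import Literature.NumberTheory.Sieve.DrappeauDispersionS1Taylor
import Literature.NumberTheory.Sieve.DrappeauDispersionS1XiSum
import Literature.NumberTheory.Sieve.DrappeauDispersionS1Classes
import Literature.NumberTheory.Sieve.DrappeauDispersionR1SmallReduction
import Literature.NumberTheory.Sieve.DrappeauDispersionCompletionInputs
import HarnessLib

/-!
# Drappeau 2017, §5.5: `ℛ₁(q₀,n₀)` from the quintilinear sums `ℛ₁''` ((5.23))

Topic `Literature/NumberTheory/Sieve`, part of the formalisation of §5 of S. Drappeau, Proc. London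
Math. Soc. (3) 114 (2017) 684–732 = arXiv:1504.05549 (Theorem 5.1 = the named fact
`Literature.NumberTheory.Sieve.Drappeau2017_theorem51`).  Everything here is PROVED; no definition
and no named fact is introduced.

§5.5 (arXiv p. 20), (5.23): `|ℛ₁'| ≪ x^ε (n₀|a₂|)² (Mq₀/Q²) sup_ξ sup_{λ₁,λ₂ mod n₀a₂} ℛ₁''` with
`ℛ₁''` the quintilinear sum of Kloosterman fractions to which Theorem 2.1 of the paper is applied
(dictionary `𝐜←q₂, 𝐝←q₁, 𝐧←a₁h(n₁−n₂)/q₀, 𝐫←a₂n₀n₂, 𝐬←n₁, 𝐪←n₀a₂`).  This file assembles the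
bricks `DrappeauDispersionS1Reindex` / `…S1PhaseSum` / `…S1Taylor` / `…S1XiSum` / `…S1Xi` /
`…S1Classes` into the reduction of the hypothesis of `Drappeau2017_theorem51_of_R1small` (pieces
`ℛ₁(q₀,n₀)` with good `q₀, n₀ ≤ x^κ`) to a bound for `ℛ₁''(ξ, λ₁, λ₂)`:

* `Drappeau2017.sum4_mul_integral_eq` — exchanging the finite sums with the `ξ`-integral;
* `Drappeau2017.R1small_of_R1pp` — the reduction (Taylor error `≪ |a₁|MNH²/(n₀S²)`,
  `ξ`-range of length `≤ 40Mq₀/(9S²)`, `(n₀|a₂|)²` classes);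
* `Drappeau2017_theorem51_of_R1pp` — hence Theorem 5.1 from the bound
  `|ℛ₁''(ξ,λ₁,λ₂)| ≤ C N²S² x^{−7κ}` (`q₀, n₀ ≤ x^κ` good; all `ξ`, `λ_j`), which is what (5.24) and
  Theorem 2.1 of the paper provide.

## References

* S. Drappeau, Proc. London Math. Soc. (3) 114 (2017) 684–732, arXiv:1504.05549, §5.5,
  (5.23)–(5.24). [cite: Drappeau2017, §5.5]
-/

noncomputable section

open Finset Real Complex MeasureTheory
open scoped FourierTransform ContDiff ArithmeticFunction.sigma

namespace Literature.NumberTheory.Sieve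

namespace Drappeau2017

/-! ### Exchanging the finite sums with the `ξ`-integral -/

/-- `∑ c ∑ w d ∫ g = ∫ ∑ c ∑ w d g` for integrable `g`. [folklore] -/
theorem sum4_mul_integral_eq (A B : Finset ℕ) (c : ℕ → ℕ → ℂ) (w : ℕ → ℕ → ℕ → ℕ → ℂ)
    (d : ℕ → ℕ → ℂ) (g : ℕ → ℕ → ℕ → ℕ → ℝ → ℂ)
    (hg : ∀ q₁ ∈ A, ∀ q₂ ∈ A, ∀ n₁ ∈ B, ∀ n₂ ∈ B, Integrable (g q₁ q₂ n₁ n₂)) :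
    ∑ q₁ ∈ A, ∑ q₂ ∈ A, c q₁ q₂ * ∑ n₁ ∈ B, ∑ n₂ ∈ B,
        w q₁ q₂ n₁ n₂ * d n₁ n₂ * ∫ ξ, g q₁ q₂ n₁ n₂ ξ =
      ∫ ξ, ∑ q₁ ∈ A, ∑ q₂ ∈ A, c q₁ q₂ * ∑ n₁ ∈ B, ∑ n₂ ∈ B,
        w q₁ q₂ n₁ n₂ * d n₁ n₂ * g q₁ q₂ n₁ n₂ ξ := by
  have hI2 : ∀ q₁ ∈ A, ∀ q₂ ∈ A, ∀ n₁ ∈ B,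
      Integrable (fun ξ => ∑ n₂ ∈ B, w q₁ q₂ n₁ n₂ * d n₁ n₂ * g q₁ q₂ n₁ n₂ ξ) :=
    fun q₁ hq₁ q₂ hq₂ n₁ hn₁ => integrable_finsetSum _ fun n₂ hn₂ =>
      (hg q₁ hq₁ q₂ hq₂ n₁ hn₁ n₂ hn₂).const_mul _
  have hI3 : ∀ q₁ ∈ A, ∀ q₂ ∈ A, Integrable (fun ξ => ∑ n₁ ∈ B, ∑ n₂ ∈ B,
      w q₁ q₂ n₁ n₂ * d n₁ n₂ * g q₁ q₂ n₁ n₂ ξ) :=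
    fun q₁ hq₁ q₂ hq₂ => integrable_finsetSum _ fun n₁ hn₁ => hI2 q₁ hq₁ q₂ hq₂ n₁ hn₁
  have hI4 : ∀ q₁ ∈ A, Integrable (fun ξ => ∑ q₂ ∈ A, c q₁ q₂ * ∑ n₁ ∈ B, ∑ n₂ ∈ B,
      w q₁ q₂ n₁ n₂ * d n₁ n₂ * g q₁ q₂ n₁ n₂ ξ) :=
    fun q₁ hq₁ => integrable_finsetSum _ fun q₂ hq₂ => (hI3 q₁ hq₁ q₂ hq₂).const_mul _
  rw [integral_finsetSum _ (fun q₁ hq₁ => hI4 q₁ hq₁)]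
  refine Finset.sum_congr rfl fun q₁ hq₁ => ?_
  rw [integral_finsetSum _ (fun q₂ hq₂ => (hI3 q₁ hq₁ q₂ hq₂).const_mul _)]
  refine Finset.sum_congr rfl fun q₂ hq₂ => ?_
  rw [integral_const_mul, integral_finsetSum _ (fun n₁ hn₁ => hI2 q₁ hq₁ q₂ hq₂ n₁ hn₁)]
  congr 1
  refine Finset.sum_congr rfl fun n₁ hn₁ => ?_
  rw [integral_finsetSum _ (fun n₂ hn₂ => (hg q₁ hq₁ q₂ hq₂ n₁ hn₁ n₂ hn₂).const_mul _)]
  refine Finset.sum_congr rfl fun n₂ _ => ?_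
  rw [integral_const_mul]

/-! ### `ℛ₁'(q₀,n₀)` as a `ξ`-integral -/

/-- **`ℛ₁'(q₀,n₀) = ∫ G(ξ) dξ`**: inserting `(M/W)ψ̂(Mh/W) = ∫ e(−hξ)ψ(Wξ/M)dξ`
(`mul_hsum_fourier_eq_integral`) in every term of `ℛ₁'` (the second sum of
`norm_R1piece_phase_sub_R1prime_le`) and exchanging the finite sums with the integral.
[cite: Drappeau2017, §5.5, (5.23)] -/
theorem R1prime_eq_integral (a₁ a₂ : ℤ) {A : Finset ℕ} (B : Finset ℕ) {q₀ : ℕ} (n₀ : ℕ)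
    (hq₀ : 0 < q₀) (hA : ∀ q ∈ A, 0 < q) (γ : ℕ → ℝ) (β : ℕ → ℂ) {M : ℝ} (hM : 0 < M) (H : ℕ) :
    ∑ q₁ ∈ A, ∑ q₂ ∈ A, (γ (q₀ * q₁) : ℂ) * (γ (q₀ * q₂) : ℂ) *
        ∑ n₁ ∈ B, ∑ n₂ ∈ B,
          (if (Nat.Coprime q₁ q₂ ∧ Nat.Coprime n₁ n₂) then (1 : ℂ) else 0) *
            (β (n₀ * n₁) * starRingEnd ℂ (β (n₀ * n₂))) *
          ((M : ℂ) / (Nat.lcm (q₀ * q₁) (q₀ * q₂) : ℂ) *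
            (if ((n₀ * n₁).Coprime (q₀ * q₁) ∧ (n₀ * n₂).Coprime (q₀ * q₂) ∧ n₁ ≡ n₂ [MOD q₀]) then
              ∑ h ∈ Finset.Icc (-(H : ℤ)) H,
                (if ((Nat.lcm (q₀ * q₁) (q₀ * q₂) : ℕ) : ℤ) ∣ h then 0 else
                  𝓕 (BFI.bumpC 1 (1 / 2)) (M * h / (Nat.lcm (q₀ * q₁) (q₀ * q₂) : ℕ)) *
                    ((𝐞 ((h : ℝ) * a₁ * ((((n₁ : ℤ) - n₂) / q₀ : ℤ)) *
                        ((((((q₁ : ℤ) * a₂ * n₀ * n₂ : ℤ) : ZMod (n₁ * q₂))⁻¹).val : ℕ) : ℝ) /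
                          ((n₁ : ℝ) * q₂)) : ℂ) *
                      (𝐞 (-((h : ℝ) * a₁ *
                        ((((((q₀ : ℤ) * q₁ * q₂ * n₁ : ℤ) : ZMod (a₂.natAbs * n₀))⁻¹).val : ℕ) : ℝ) /
                          ((a₂ : ℝ) * n₀))) : ℂ)))
            else 0)) =
      ∫ ξ : ℝ, ∑ q₁ ∈ A, ∑ q₂ ∈ A, (γ (q₀ * q₁) : ℂ) * (γ (q₀ * q₂) : ℂ) *
        ∑ n₁ ∈ B, ∑ n₂ ∈ B,
          (if (Nat.Coprime q₁ q₂ ∧ Nat.Coprime n₁ n₂) then (1 : ℂ) else 0) *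
            (β (n₀ * n₁) * starRingEnd ℂ (β (n₀ * n₂))) *
          (if ((n₀ * n₁).Coprime (q₀ * q₁) ∧ (n₀ * n₂).Coprime (q₀ * q₂) ∧ n₁ ≡ n₂ [MOD q₀]) then
              ∑ h ∈ Finset.Icc (-(H : ℤ)) H,
                (if ((Nat.lcm (q₀ * q₁) (q₀ * q₂) : ℕ) : ℤ) ∣ h then 0 else
                  (𝐞 (-(ξ * h)) : ℂ) * BFI.bumpC 1 (1 / 2) ((Nat.lcm (q₀ * q₁) (q₀ * q₂) : ℕ) * ξ / M) *
                    ((𝐞 ((h : ℝ) * a₁ * ((((n₁ : ℤ) - n₂) / q₀ : ℤ)) *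
                        ((((((q₁ : ℤ) * a₂ * n₀ * n₂ : ℤ) : ZMod (n₁ * q₂))⁻¹).val : ℕ) : ℝ) /
                          ((n₁ : ℝ) * q₂)) : ℂ) *
                      (𝐞 (-((h : ℝ) * a₁ *
                        ((((((q₀ : ℤ) * q₁ * q₂ * n₁ : ℤ) : ZMod (a₂.natAbs * n₀))⁻¹).val : ℕ) : ℝ) /
                          ((a₂ : ℝ) * n₀))) : ℂ)))
            else 0) := by
  -- the integrand, termwise
  have hW : ∀ q₁ ∈ A, ∀ q₂ ∈ A, 0 < Nat.lcm (q₀ * q₁) (q₀ * q₂) := fun q₁ hq₁ q₂ hq₂ =>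
    Nat.lcm_pos (Nat.mul_pos hq₀ (hA q₁ hq₁)) (Nat.mul_pos hq₀ (hA q₂ hq₂))
  -- rewrite every term as an integral
  have hterm : ∀ q₁ ∈ A, ∀ q₂ ∈ A, ∀ n₁ n₂ : ℕ,
      (M : ℂ) / (Nat.lcm (q₀ * q₁) (q₀ * q₂) : ℂ) *
        (if ((n₀ * n₁).Coprime (q₀ * q₁) ∧ (n₀ * n₂).Coprime (q₀ * q₂) ∧ n₁ ≡ n₂ [MOD q₀]) then
          ∑ h ∈ Finset.Icc (-(H : ℤ)) H,
            (if ((Nat.lcm (q₀ * q₁) (q₀ * q₂) : ℕ) : ℤ) ∣ h then 0 else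
              𝓕 (BFI.bumpC 1 (1 / 2)) (M * h / (Nat.lcm (q₀ * q₁) (q₀ * q₂) : ℕ)) *
                ((𝐞 ((h : ℝ) * a₁ * ((((n₁ : ℤ) - n₂) / q₀ : ℤ)) *
                        ((((((q₁ : ℤ) * a₂ * n₀ * n₂ : ℤ) : ZMod (n₁ * q₂))⁻¹).val : ℕ) : ℝ) /
                          ((n₁ : ℝ) * q₂)) : ℂ) *
                  (𝐞 (-((h : ℝ) * a₁ *
                        ((((((q₀ : ℤ) * q₁ * q₂ * n₁ : ℤ) : ZMod (a₂.natAbs * n₀))⁻¹).val : ℕ) : ℝ) /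
                          ((a₂ : ℝ) * n₀))) : ℂ)))
        else 0) =
      ∫ ξ : ℝ, (if ((n₀ * n₁).Coprime (q₀ * q₁) ∧ (n₀ * n₂).Coprime (q₀ * q₂) ∧ n₁ ≡ n₂ [MOD q₀]) then
          ∑ h ∈ Finset.Icc (-(H : ℤ)) H,
            (if ((Nat.lcm (q₀ * q₁) (q₀ * q₂) : ℕ) : ℤ) ∣ h then 0 else
              (𝐞 (-(ξ * h)) : ℂ) * BFI.bumpC 1 (1 / 2) ((Nat.lcm (q₀ * q₁) (q₀ * q₂) : ℕ) * ξ / M) *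
                ((𝐞 ((h : ℝ) * a₁ * ((((n₁ : ℤ) - n₂) / q₀ : ℤ)) *
                        ((((((q₁ : ℤ) * a₂ * n₀ * n₂ : ℤ) : ZMod (n₁ * q₂))⁻¹).val : ℕ) : ℝ) /
                          ((n₁ : ℝ) * q₂)) : ℂ) *
                  (𝐞 (-((h : ℝ) * a₁ *
                        ((((((q₀ : ℤ) * q₁ * q₂ * n₁ : ℤ) : ZMod (a₂.natAbs * n₀))⁻¹).val : ℕ) : ℝ) /
                          ((a₂ : ℝ) * n₀))) : ℂ)))
        else 0) := by
    intro q₁ hq₁ q₂ hq₂ n₁ n₂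
    by_cases hc : ((n₀ * n₁).Coprime (q₀ * q₁) ∧ (n₀ * n₂).Coprime (q₀ * q₂) ∧ n₁ ≡ n₂ [MOD q₀])
    · simp only [if_pos hc]
      have key := mul_hsum_fourier_eq_integral hM (hW q₁ hq₁ q₂ hq₂) (Finset.Icc (-(H : ℤ)) H)
        (fun h : ℤ => (𝐞 ((h : ℝ) * a₁ * ((((n₁ : ℤ) - n₂) / q₀ : ℤ)) *
                        ((((((q₁ : ℤ) * a₂ * n₀ * n₂ : ℤ) : ZMod (n₁ * q₂))⁻¹).val : ℕ) : ℝ) /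
                          ((n₁ : ℝ) * q₂)) : ℂ) *
          (𝐞 (-((h : ℝ) * a₁ *
                        ((((((q₀ : ℤ) * q₁ * q₂ * n₁ : ℤ) : ZMod (a₂.natAbs * n₀))⁻¹).val : ℕ) : ℝ) /
                          ((a₂ : ℝ) * n₀))) : ℂ))
      beta_reduce at key
      exact key
    · simp only [if_neg hc, mul_zero, integral_zero]
  -- integrability of the integrand terms
  have hint : ∀ q₁ ∈ A, ∀ q₂ ∈ A, ∀ n₁ n₂ : ℕ, Integrable (fun ξ : ℝ => (if ((n₀ * n₁).Coprime (q₀ * q₁) ∧ (n₀ * n₂).Coprime (q₀ * q₂) ∧ n₁ ≡ n₂ [MOD q₀]) then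
          ∑ h ∈ Finset.Icc (-(H : ℤ)) H,
            (if ((Nat.lcm (q₀ * q₁) (q₀ * q₂) : ℕ) : ℤ) ∣ h then 0 else
              (𝐞 (-(ξ * h)) : ℂ) * BFI.bumpC 1 (1 / 2) ((Nat.lcm (q₀ * q₁) (q₀ * q₂) : ℕ) * ξ / M) *
                ((𝐞 ((h : ℝ) * a₁ * ((((n₁ : ℤ) - n₂) / q₀ : ℤ)) *
                        ((((((q₁ : ℤ) * a₂ * n₀ * n₂ : ℤ) : ZMod (n₁ * q₂))⁻¹).val : ℕ) : ℝ) /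
                          ((n₁ : ℝ) * q₂)) : ℂ) *
                  (𝐞 (-((h : ℝ) * a₁ *
                        ((((((q₀ : ℤ) * q₁ * q₂ * n₁ : ℤ) : ZMod (a₂.natAbs * n₀))⁻¹).val : ℕ) : ℝ) /
                          ((a₂ : ℝ) * n₀))) : ℂ)))
        else 0)) := by
    intro q₁ hq₁ q₂ hq₂ n₁ n₂
    by_cases hc : ((n₀ * n₁).Coprime (q₀ * q₁) ∧ (n₀ * n₂).Coprime (q₀ * q₂) ∧ n₁ ≡ n₂ [MOD q₀])
    · simp only [if_pos hc]
      refine integrable_finsetSum _ fun h _ => ?_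
      by_cases hd : ((Nat.lcm (q₀ * q₁) (q₀ * q₂) : ℕ) : ℤ) ∣ h
      · simp only [if_pos hd]; exact integrable_zero _ _ _
      · simp only [if_neg hd]
        exact integrable_fourierChar_mul_bumpC_scaled hM (by exact_mod_cast hW q₁ hq₁ q₂ hq₂) _ _
    · simp only [if_neg hc]; exact integrable_zero _ _ _
  -- assemble
  calc _ = ∑ q₁ ∈ A, ∑ q₂ ∈ A, (γ (q₀ * q₁) : ℂ) * (γ (q₀ * q₂) : ℂ) *
        ∑ n₁ ∈ B, ∑ n₂ ∈ B,
          (if (Nat.Coprime q₁ q₂ ∧ Nat.Coprime n₁ n₂) then (1 : ℂ) else 0) *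
            (β (n₀ * n₁) * starRingEnd ℂ (β (n₀ * n₂))) *
          ∫ ξ : ℝ, (if ((n₀ * n₁).Coprime (q₀ * q₁) ∧ (n₀ * n₂).Coprime (q₀ * q₂) ∧ n₁ ≡ n₂ [MOD q₀]) then
              ∑ h ∈ Finset.Icc (-(H : ℤ)) H,
                (if ((Nat.lcm (q₀ * q₁) (q₀ * q₂) : ℕ) : ℤ) ∣ h then 0 else
                  (𝐞 (-(ξ * h)) : ℂ) * BFI.bumpC 1 (1 / 2) ((Nat.lcm (q₀ * q₁) (q₀ * q₂) : ℕ) * ξ / M) *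
                    ((𝐞 ((h : ℝ) * a₁ * ((((n₁ : ℤ) - n₂) / q₀ : ℤ)) *
                        ((((((q₁ : ℤ) * a₂ * n₀ * n₂ : ℤ) : ZMod (n₁ * q₂))⁻¹).val : ℕ) : ℝ) /
                          ((n₁ : ℝ) * q₂)) : ℂ) *
                      (𝐞 (-((h : ℝ) * a₁ *
                        ((((((q₀ : ℤ) * q₁ * q₂ * n₁ : ℤ) : ZMod (a₂.natAbs * n₀))⁻¹).val : ℕ) : ℝ) /
                          ((a₂ : ℝ) * n₀))) : ℂ)))
            else 0) := by
        refine Finset.sum_congr rfl fun q₁ hq₁ => Finset.sum_congr rfl fun q₂ hq₂ => ?_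
        congr 1
        refine Finset.sum_congr rfl fun n₁ _ => Finset.sum_congr rfl fun n₂ _ => ?_
        rw [hterm q₁ hq₁ q₂ hq₂ n₁ n₂]
    _ = _ := by
        refine (sum4_mul_integral_eq A B (fun q₁ q₂ => (γ (q₀ * q₁) : ℂ) * (γ (q₀ * q₂) : ℂ))
          (fun q₁ q₂ n₁ n₂ => if (Nat.Coprime q₁ q₂ ∧ Nat.Coprime n₁ n₂) then (1 : ℂ) else 0)
          (fun n₁ n₂ => β (n₀ * n₁) * starRingEnd ℂ (β (n₀ * n₂))) (fun q₁ q₂ n₁ n₂ ξ =>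
            (if ((n₀ * n₁).Coprime (q₀ * q₁) ∧ (n₀ * n₂).Coprime (q₀ * q₂) ∧ n₁ ≡ n₂ [MOD q₀]) then
              ∑ h ∈ Finset.Icc (-(H : ℤ)) H,
                (if ((Nat.lcm (q₀ * q₁) (q₀ * q₂) : ℕ) : ℤ) ∣ h then 0 else
                  (𝐞 (-(ξ * h)) : ℂ) * BFI.bumpC 1 (1 / 2) ((Nat.lcm (q₀ * q₁) (q₀ * q₂) : ℕ) * ξ / M) *
                    ((𝐞 ((h : ℝ) * a₁ * ((((n₁ : ℤ) - n₂) / q₀ : ℤ)) *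
                        ((((((q₁ : ℤ) * a₂ * n₀ * n₂ : ℤ) : ZMod (n₁ * q₂))⁻¹).val : ℕ) : ℝ) /
                          ((n₁ : ℝ) * q₂)) : ℂ) *
                      (𝐞 (-((h : ℝ) * a₁ *
                        ((((((q₀ : ℤ) * q₁ * q₂ * n₁ : ℤ) : ZMod (a₂.natAbs * n₀))⁻¹).val : ℕ) : ℝ) /
                          ((a₂ : ℝ) * n₀))) : ℂ)))
            else 0)) fun q₁ hq₁ q₂ hq₂ n₁ _ n₂ _ => hint q₁ hq₁ q₂ hq₂ n₁ n₂).trans ?_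
        rfl

/-! ### The integrand: classes modulo `|a₂|n₀`, and its support -/

/-- **Classes modulo `m = |a₂|n₀`** ((5.23)): the integrand `G(ξ)` of `R1prime_eq_integral` is
`∑_{λ₁,λ₂<m} ℛ₁''(ξ,λ₁,λ₂)`, where in `ℛ₁''` the moduli run over the classes `q_j ≡ λ_j (m)` and the
phase `e(−a₁h\overline{q₀q₁q₂n₁}/(a₂n₀))` has become `e(−a₁h\overline{q₀λ₁λ₂n₁}/(a₂n₀))`.
[cite: Drappeau2017, §5.5, (5.23)] -/
theorem integrand_eq_sum_classes (a₁ : ℤ) {a₂ : ℤ} (ha₂ : a₂ ≠ 0) (A B : Finset ℕ) (q₀ : ℕ) {n₀ : ℕ}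
    (hn₀ : 0 < n₀) (γ : ℕ → ℝ) (β : ℕ → ℂ) (M : ℝ) (H : ℕ) (ξ : ℝ) :
    ∑ q₁ ∈ A, ∑ q₂ ∈ A, (γ (q₀ * q₁) : ℂ) * (γ (q₀ * q₂) : ℂ) *
        ∑ n₁ ∈ B, ∑ n₂ ∈ B,
          (if (Nat.Coprime q₁ q₂ ∧ Nat.Coprime n₁ n₂) then (1 : ℂ) else 0) *
            (β (n₀ * n₁) * starRingEnd ℂ (β (n₀ * n₂))) *
          (if ((n₀ * n₁).Coprime (q₀ * q₁) ∧ (n₀ * n₂).Coprime (q₀ * q₂) ∧ n₁ ≡ n₂ [MOD q₀]) then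
              ∑ h ∈ Finset.Icc (-(H : ℤ)) H,
                (if ((Nat.lcm (q₀ * q₁) (q₀ * q₂) : ℕ) : ℤ) ∣ h then 0 else
                  (𝐞 (-(ξ * h)) : ℂ) * BFI.bumpC 1 (1 / 2) ((Nat.lcm (q₀ * q₁) (q₀ * q₂) : ℕ) * ξ / M) *
                    ((𝐞 ((h : ℝ) * a₁ * ((((n₁ : ℤ) - n₂) / q₀ : ℤ)) *
                        ((((((q₁ : ℤ) * a₂ * n₀ * n₂ : ℤ) : ZMod (n₁ * q₂))⁻¹).val : ℕ) : ℝ) /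
                          ((n₁ : ℝ) * q₂)) : ℂ) *
                      (𝐞 (-((h : ℝ) * a₁ *
                        ((((((q₀ : ℤ) * q₁ * q₂ * n₁ : ℤ) : ZMod (a₂.natAbs * n₀))⁻¹).val : ℕ) : ℝ) /
                          ((a₂ : ℝ) * n₀))) : ℂ)))
            else 0) =
      ∑ l₁ ∈ Finset.range (a₂.natAbs * n₀), ∑ l₂ ∈ Finset.range (a₂.natAbs * n₀),
        ∑ q₁ ∈ A.filter (fun q : ℕ => q % (a₂.natAbs * n₀) = l₁), ∑ q₂ ∈ A.filter (fun q : ℕ => q % (a₂.natAbs * n₀) = l₂), (γ (q₀ * q₁) : ℂ) * (γ (q₀ * q₂) : ℂ) *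
        ∑ n₁ ∈ B, ∑ n₂ ∈ B,
          (if (Nat.Coprime q₁ q₂ ∧ Nat.Coprime n₁ n₂) then (1 : ℂ) else 0) *
            (β (n₀ * n₁) * starRingEnd ℂ (β (n₀ * n₂))) *
          (if ((n₀ * n₁).Coprime (q₀ * q₁) ∧ (n₀ * n₂).Coprime (q₀ * q₂) ∧ n₁ ≡ n₂ [MOD q₀]) then
              ∑ h ∈ Finset.Icc (-(H : ℤ)) H,
                (if ((Nat.lcm (q₀ * q₁) (q₀ * q₂) : ℕ) : ℤ) ∣ h then 0 else
                  (𝐞 (-(ξ * h)) : ℂ) * BFI.bumpC 1 (1 / 2) ((Nat.lcm (q₀ * q₁) (q₀ * q₂) : ℕ) * ξ / M) *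
                    ((𝐞 ((h : ℝ) * a₁ * ((((n₁ : ℤ) - n₂) / q₀ : ℤ)) *
                        ((((((q₁ : ℤ) * a₂ * n₀ * n₂ : ℤ) : ZMod (n₁ * q₂))⁻¹).val : ℕ) : ℝ) /
                          ((n₁ : ℝ) * q₂)) : ℂ) *
                      (𝐞 (-((h : ℝ) * a₁ *
                        ((((((q₀ : ℤ) * l₁ * l₂ * n₁ : ℤ) : ZMod (a₂.natAbs * n₀))⁻¹).val : ℕ) : ℝ) /
                          ((a₂ : ℝ) * n₀))) : ℂ)))
            else 0) := by
  have hm : 0 < a₂.natAbs * n₀ := Nat.mul_pos (Int.natAbs_pos.2 ha₂) hn₀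
  simp_rw [sum_eq_sum_range_sum_filter_mod hm A]
  refine Finset.sum_congr rfl fun l₁ _ => ?_
  rw [Finset.sum_comm]
  refine Finset.sum_congr rfl fun l₂ _ => Finset.sum_congr rfl fun q₁ hq₁ =>
    Finset.sum_congr rfl fun q₂ hq₂ => ?_
  have h₁ : q₁ % (a₂.natAbs * n₀) = l₁ := (Finset.mem_filter.1 hq₁).2
  have h₂ : q₂ % (a₂.natAbs * n₀) = l₂ := (Finset.mem_filter.1 hq₂).2
  simp only [intCast_prod_eq_of_mod_eq (q₀ := q₀) h₁ h₂]

/-- **The `ξ`-range** ((5.23): "`sup_{ξ ≍ Mq₀/Q²}`"): for `γ = BFI.bump S Y` (`0 < Y ≤ S/4`) the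
integrand vanishes unless `8Mq₀/(81S²) ≤ ξ ≤ 40Mq₀/(9S²)`: a non-zero term has `(q₁,q₂) = 1`,
`3S/4 < q₀q_j < 9S/4`, so `W = q₀q₁q₂ ∈ (9S²/(16q₀), 81S²/(16q₀))`, and `ψ(Wξ/M) ≠ 0` forces
`1/2 < Wξ/M < 5/2` (`ψ = BFI.bumpC 1 (1/2)`). [cite: Drappeau2017, §5.5, (5.23)] -/
theorem integrand_eq_zero_of_not_mem_Icc (a₁ a₂ : ℤ) {A : Finset ℕ} (B : Finset ℕ) {q₀ : ℕ} (n₀ : ℕ)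
    (hq₀ : 0 < q₀) (hA : ∀ q ∈ A, 0 < q) {S Y M : ℝ} (hS : 0 < S) (hY : 0 < Y) (hYS : Y ≤ S / 4)
    (hM : 0 < M) (β : ℕ → ℂ) (H : ℕ) {ξ : ℝ}
    (hξ : ξ ∉ Set.Icc (8 * M * q₀ / (81 * S ^ 2)) (40 * M * q₀ / (9 * S ^ 2))) :
    ∑ q₁ ∈ A, ∑ q₂ ∈ A, ((BFI.bump S Y ((q₀ * q₁ : ℕ) : ℝ) : ℝ) : ℂ) * ((BFI.bump S Y ((q₀ * q₂ : ℕ) : ℝ) : ℝ) : ℂ) *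
        ∑ n₁ ∈ B, ∑ n₂ ∈ B,
          (if (Nat.Coprime q₁ q₂ ∧ Nat.Coprime n₁ n₂) then (1 : ℂ) else 0) *
            (β (n₀ * n₁) * starRingEnd ℂ (β (n₀ * n₂))) *
          (if ((n₀ * n₁).Coprime (q₀ * q₁) ∧ (n₀ * n₂).Coprime (q₀ * q₂) ∧ n₁ ≡ n₂ [MOD q₀]) then
              ∑ h ∈ Finset.Icc (-(H : ℤ)) H,
                (if ((Nat.lcm (q₀ * q₁) (q₀ * q₂) : ℕ) : ℤ) ∣ h then 0 else
                  (𝐞 (-(ξ * h)) : ℂ) * BFI.bumpC 1 (1 / 2) ((Nat.lcm (q₀ * q₁) (q₀ * q₂) : ℕ) * ξ / M) *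
                    ((𝐞 ((h : ℝ) * a₁ * ((((n₁ : ℤ) - n₂) / q₀ : ℤ)) *
                        ((((((q₁ : ℤ) * a₂ * n₀ * n₂ : ℤ) : ZMod (n₁ * q₂))⁻¹).val : ℕ) : ℝ) /
                          ((n₁ : ℝ) * q₂)) : ℂ) *
                      (𝐞 (-((h : ℝ) * a₁ *
                        ((((((q₀ : ℤ) * q₁ * q₂ * n₁ : ℤ) : ZMod (a₂.natAbs * n₀))⁻¹).val : ℕ) : ℝ) /
                          ((a₂ : ℝ) * n₀))) : ℂ)))
            else 0) = 0 := by
  have hq₀r : (0 : ℝ) < q₀ := by exact_mod_cast hq₀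
  rw [Set.mem_Icc, not_and_or, not_le, not_le] at hξ
  refine Finset.sum_eq_zero fun q₁ hq₁ => Finset.sum_eq_zero fun q₂ hq₂ => ?_
  -- the weights
  by_cases hγ₁ : BFI.bump S Y ((q₀ * q₁ : ℕ) : ℝ) = 0
  · rw [hγ₁]; simp
  by_cases hγ₂ : BFI.bump S Y ((q₀ * q₂ : ℕ) : ℝ) = 0
  · rw [hγ₂]; simp
  have hrange : ∀ q : ℕ, BFI.bump S Y ((q₀ * q : ℕ) : ℝ) ≠ 0 →
      3 * S / 4 < ((q₀ * q : ℕ) : ℝ) ∧ ((q₀ * q : ℕ) : ℝ) < 9 * S / 4 := by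
    intro q hq
    constructor
    · by_contra h
      exact hq (BFI.bump_eq_zero_of_le hY hS.le (by linarith [not_lt.1 h]))
    · by_contra h
      exact hq (BFI.bump_eq_zero_of_ge hY hS.le (by linarith [not_lt.1 h]))
  obtain ⟨hl₁, hu₁⟩ := hrange q₁ hγ₁
  obtain ⟨hl₂, hu₂⟩ := hrange q₂ hγ₂
  rw [mul_eq_zero]; right
  refine Finset.sum_eq_zero fun n₁ _ => Finset.sum_eq_zero fun n₂ _ => ?_
  by_cases hcop : (Nat.Coprime q₁ q₂ ∧ Nat.Coprime n₁ n₂)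
  swap
  · rw [if_neg hcop]; simp
  rw [if_pos hcop, one_mul, mul_eq_zero]; right
  split_ifs with hc
  swap
  · rfl
  -- `W = q₀q₁q₂` and `ψ(Wξ/M) = 0`
  have hW : Nat.lcm (q₀ * q₁) (q₀ * q₂) = q₀ * q₁ * q₂ := by
    rw [Nat.lcm_mul_left, hcop.1.lcm_eq_mul, mul_assoc]
  have hWr : ((Nat.lcm (q₀ * q₁) (q₀ * q₂) : ℕ) : ℝ) * q₀ = ((q₀ * q₁ : ℕ) : ℝ) * ((q₀ * q₂ : ℕ) : ℝ) := by
    rw [hW]; push_cast; ring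
  have hWpos : (0 : ℝ) < ((Nat.lcm (q₀ * q₁) (q₀ * q₂) : ℕ) : ℝ) := by
    rw [hW]; exact_mod_cast Nat.mul_pos (Nat.mul_pos hq₀ (hA q₁ hq₁)) (hA q₂ hq₂)
  -- bounds for `W q₀`
  have hWl : (3 * S / 4) * (3 * S / 4) < ((Nat.lcm (q₀ * q₁) (q₀ * q₂) : ℕ) : ℝ) * q₀ := by
    rw [hWr]; exact mul_lt_mul'' hl₁ hl₂ (by positivity) (by positivity)
  have hWu : ((Nat.lcm (q₀ * q₁) (q₀ * q₂) : ℕ) : ℝ) * q₀ < (9 * S / 4) * (9 * S / 4) := by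
    rw [hWr]; exact mul_lt_mul'' hu₁ hu₂ (by positivity) (by positivity)
  have hψ : BFI.bumpC 1 (1 / 2) (((Nat.lcm (q₀ * q₁) (q₀ * q₂) : ℕ) : ℝ) * ξ / M) = 0 := by
    refine BFI.bumpC_eq_zero (by norm_num) zero_le_one ?_
    rcases hξ with hξ | hξ
    · left
      rw [div_le_iff₀ hM]
      by_cases hξ0 : ξ ≤ 0
      · have : ((Nat.lcm (q₀ * q₁) (q₀ * q₂) : ℕ) : ℝ) * ξ ≤ 0 :=
          mul_nonpos_of_nonneg_of_nonpos hWpos.le hξ0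
        linarith
      · have hξpos : 0 < ξ := lt_of_not_ge hξ0
        have h1 : ((Nat.lcm (q₀ * q₁) (q₀ * q₂) : ℕ) : ℝ) * ξ * (81 * S ^ 2) <
            ((Nat.lcm (q₀ * q₁) (q₀ * q₂) : ℕ) : ℝ) * (8 * M * q₀) := by
          rw [mul_assoc]
          refine mul_lt_mul_of_pos_left ?_ hWpos
          rwa [lt_div_iff₀ (by positivity)] at hξ
        have h2 : ((Nat.lcm (q₀ * q₁) (q₀ * q₂) : ℕ) : ℝ) * (8 * M * q₀) <
            (1 / 2 * M) * (81 * S ^ 2) := by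
          nlinarith [hWu, hM]
        have h4 := lt_of_mul_lt_mul_right (h1.trans h2) (by positivity)
        linarith
    · right
      rw [le_div_iff₀ hM]
      have h1 : ((Nat.lcm (q₀ * q₁) (q₀ * q₂) : ℕ) : ℝ) * (40 * M * q₀) <
          ((Nat.lcm (q₀ * q₁) (q₀ * q₂) : ℕ) : ℝ) * ξ * (9 * S ^ 2) := by
        rw [mul_assoc (((Nat.lcm (q₀ * q₁) (q₀ * q₂) : ℕ) : ℝ)) ξ]
        refine mul_lt_mul_of_pos_left ?_ hWpos
        rwa [div_lt_iff₀ (by positivity)] at hξ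
      have h2 : ((2 * 1 + 1 / 2) * M) * (9 * S ^ 2) <
          ((Nat.lcm (q₀ * q₁) (q₀ * q₂) : ℕ) : ℝ) * (40 * M * q₀) := by
        nlinarith [hWl, hM]
      have h3 := lt_of_mul_lt_mul_right (h2.trans h1) (by positivity)
      linarith
  refine Finset.sum_eq_zero fun h _ => ?_
  split_ifs
  · rfl
  · rw [hψ, mul_zero, zero_mul]

/-! ### The reduction `ℛ₁'' ⟹ ℛ₁(q₀,n₀)` -/

/-- Bookkeeping for the final combination: `|P₀| ≤ T₁ + U` from `P₀ = P₁`, `|P₁ − P₂| ≤ T ≤ T₁`,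
`P₂ = I`, `|I| ≤ U`. [folklore] -/
private theorem combine_key {P₀ P₀' P₁ P₂ I : ℂ} {T T₁ U V : ℝ} (e₀ : P₀ = P₀') (e₁ : P₀' = P₁)
    (hT : ‖P₁ - P₂‖ ≤ T) (hT₁ : T ≤ T₁) (hI : P₂ = I) (hU : ‖I‖ ≤ U) (hV : T₁ + U ≤ V) :
    ‖P₀‖ ≤ V := by
  rw [e₀, e₁]
  have := norm_le_norm_add_norm_sub' P₁ P₂
  rw [hI] at hT this
  linarith

set_option maxHeartbeats 1600000 in
/-- **§5.5, (5.22)–(5.23): the pieces `ℛ₁(q₀,n₀)` from the quintilinear sums `ℛ₁''`** (core,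
`ε₁, κ, η` fixed; the conclusion is for `κ' = min κ (1/100)`).  Assume
the bound `|ℛ₁''(ξ,λ₁,λ₂)| ≤ C N²S² x^{−7κ}` for all `ξ`, all classes `λ₁, λ₂ (mod |a₂|n₀)` and all
good `q₀, n₀ ≤ x^κ` (this is what (5.24) and Theorem 2.1 of the paper provide, with
`H = ⌈9S²x^{ε₁}/M⌉`, `ε₁ ≤ 1/25`).  Then the hypothesis of `Drappeau2017_theorem51_of_R1small`
holds: by `R1piece_eq_reindex` and `R1piece_reindexed_eq_phase` ((5.22)) the piece `ℛ₁(q₀,n₀)` is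
the phase sum `P₁`; by `norm_R1piece_phase_sub_R1prime_le` (Taylor) `|P₁ − ℛ₁'| ≪ |a₁|MNH²q₀²n₀/S²`,
acceptable; by `R1prime_eq_integral`, `integrand_eq_zero_of_not_mem_Icc` and
`integrand_eq_sum_classes`, `|ℛ₁'| ≤ (40Mq₀/(9S²)) (|a₂|n₀)² sup_{ξ,λ} |ℛ₁''| ≪ C M N² x^{−3.5κ}`.
[cite: Drappeau2017, §5.5, (5.23)] -/
theorem R1small_of_R1pp_core {ε₁ κ η : ℝ} (hε₁s : ε₁ ≤ 1 / 25) (hκ : 0 < κ) (hη : 0 < η)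
    (HR : ∃ δ : ℝ, 0 < δ ∧
      ∀ Aτ : ℝ, 0 ≤ Aτ → ∃ C x₀ : ℝ, ∀ x : ℝ, x₀ ≤ x →
      ∀ M N S Rd Y : ℝ, M * N = x → x ^ η ≤ N → N ≤ S ^ (2 / 3 - η) → x ^ (1 / 4 : ℝ) ≤ S →
        S ≤ x ^ (1 / 2 + δ) → 1 ≤ Rd → Rd ≤ x ^ δ → S * x ^ (-δ) ≤ Y → Y ≤ S / 4 →
      ∀ a₁ a₂ : ℤ, a₁ ≠ 0 → a₂ ≠ 0 → (|a₁| : ℝ) ≤ x ^ δ → (|a₂| : ℝ) ≤ x ^ δ →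
      ∀ β : ℕ → ℂ, (∀ n, ‖β n‖ ≤ (σ 0 n : ℝ) ^ Aτ) → (∀ n, ¬Squarefree n → β n = 0) →
      ∀ q₀ n₀ : ℕ, 0 < q₀ → (q₀ : ℝ) ≤ x ^ κ → 0 < n₀ → (n₀ : ℝ) ≤ x ^ κ → Nat.Coprime q₀ n₀ →
        IsCoprime (q₀ : ℤ) (a₁ * a₂) → IsCoprime (n₀ : ℤ) a₂ →
      ∀ ξ : ℝ, ∀ l₁ l₂ : ℕ,
        ‖∑ q₁ ∈ (((((BFI.mRange S Y).filter (fun q : ℕ => 0 < q)).filter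
              (fun q : ℕ => IsCoprime (q : ℤ) (a₁ * a₂))).filter (fun q : ℕ => q₀ ∣ q)).image (fun q : ℕ => q / q₀)).filter (fun q : ℕ => q % (a₂.natAbs * n₀) = l₁),
          ∑ q₂ ∈ (((((BFI.mRange S Y).filter (fun q : ℕ => 0 < q)).filter
              (fun q : ℕ => IsCoprime (q : ℤ) (a₁ * a₂))).filter (fun q : ℕ => q₀ ∣ q)).image (fun q : ℕ => q / q₀)).filter (fun q : ℕ => q % (a₂.natAbs * n₀) = l₂),
          ((BFI.bump S Y ((q₀ * q₁ : ℕ) : ℝ) : ℝ) : ℂ) * ((BFI.bump S Y ((q₀ * q₂ : ℕ) : ℝ) : ℝ) : ℂ) *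
        ∑ n₁ ∈ (((BFI.dyadic N).filter (fun n : ℕ => IsCoprime (n : ℤ) a₂)).filter (fun n : ℕ => n₀ ∣ n)).image (fun n : ℕ => n / n₀),
          ∑ n₂ ∈ (((BFI.dyadic N).filter (fun n : ℕ => IsCoprime (n : ℤ) a₂)).filter (fun n : ℕ => n₀ ∣ n)).image (fun n : ℕ => n / n₀),
          (if (Nat.Coprime q₁ q₂ ∧ Nat.Coprime n₁ n₂) then (1 : ℂ) else 0) *
            (β (n₀ * n₁) * starRingEnd ℂ (β (n₀ * n₂))) *
          (if ((n₀ * n₁).Coprime (q₀ * q₁) ∧ (n₀ * n₂).Coprime (q₀ * q₂) ∧ n₁ ≡ n₂ [MOD q₀]) then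
              ∑ h ∈ Finset.Icc (-(⌈(3 * S) ^ 2 * x ^ ε₁ / M⌉₊ : ℤ)) ⌈(3 * S) ^ 2 * x ^ ε₁ / M⌉₊,
                (if ((Nat.lcm (q₀ * q₁) (q₀ * q₂) : ℕ) : ℤ) ∣ h then 0 else
                  (𝐞 (-(ξ * h)) : ℂ) * BFI.bumpC 1 (1 / 2) ((Nat.lcm (q₀ * q₁) (q₀ * q₂) : ℕ) * ξ / M) *
                    ((𝐞 ((h : ℝ) * a₁ * ((((n₁ : ℤ) - n₂) / q₀ : ℤ)) *
                        ((((((q₁ : ℤ) * a₂ * n₀ * n₂ : ℤ) : ZMod (n₁ * q₂))⁻¹).val : ℕ) : ℝ) /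
                          ((n₁ : ℝ) * q₂)) : ℂ) *
                      (𝐞 (-((h : ℝ) * a₁ *
                        ((((((q₀ : ℤ) * l₁ * l₂ * n₁ : ℤ) : ZMod (a₂.natAbs * n₀))⁻¹).val : ℕ) : ℝ) /
                          ((a₂ : ℝ) * n₀))) : ℂ)))
            else 0)‖ ≤
          C * N ^ 2 * S ^ 2 * x ^ (-7 * κ)) :
    ∃ δ : ℝ, 0 < δ ∧ ∀ Aτ : ℝ, 0 ≤ Aτ →
      ∃ C x₀ : ℝ, ∀ x : ℝ, x₀ ≤ x →
      ∀ M N S Rd Y : ℝ, M * N = x → x ^ η ≤ N → N ≤ S ^ (2 / 3 - η) → x ^ (1 / 4 : ℝ) ≤ S →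
        S ≤ x ^ (1 / 2 + δ) → 1 ≤ Rd → Rd ≤ x ^ δ → S * x ^ (-δ) ≤ Y → Y ≤ S / 4 →
      ∀ a₁ a₂ : ℤ, a₁ ≠ 0 → a₂ ≠ 0 → (|a₁| : ℝ) ≤ x ^ δ → (|a₂| : ℝ) ≤ x ^ δ →
      ∀ β : ℕ → ℂ, (∀ n, ‖β n‖ ≤ (σ 0 n : ℝ) ^ Aτ) → (∀ n, ¬Squarefree n → β n = 0) →
      ∀ q₀ n₀ : ℕ, 0 < q₀ → (q₀ : ℝ) ≤ x ^ min κ (1 / 100) → 0 < n₀ → (n₀ : ℝ) ≤ x ^ min κ (1 / 100) → Nat.Coprime q₀ n₀ →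
        IsCoprime (q₀ : ℤ) (a₁ * a₂) → IsCoprime (n₀ : ℤ) a₂ →
        ‖∑ q₁ ∈ ((BFI.mRange S Y).filter (fun q : ℕ => 0 < q)).filter
              (fun q : ℕ => IsCoprime (q : ℤ) (a₁ * a₂)),
          ∑ q₂ ∈ ((BFI.mRange S Y).filter (fun q : ℕ => 0 < q)).filter
              (fun q : ℕ => IsCoprime (q : ℤ) (a₁ * a₂)),
            ((BFI.bump S Y q₁ : ℝ) : ℂ) * ((BFI.bump S Y q₂ : ℝ) : ℂ) *
            ∑ n₁ ∈ (BFI.dyadic N).filter (fun n : ℕ => IsCoprime (n : ℤ) a₂),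
              ∑ n₂ ∈ (BFI.dyadic N).filter (fun n : ℕ => IsCoprime (n : ℤ) a₂),
                (if (Nat.gcd q₁ q₂ = q₀ ∧ Nat.gcd n₁ n₂ = n₀) then (1 : ℂ) else 0) *
                  (β n₁ * starRingEnd ℂ (β n₂)) *
                ((M : ℂ) / (Nat.lcm q₁ q₂ : ℂ) *
                  ∑ b ∈ (Finset.range (Nat.lcm q₁ q₂)).filter (fun b : ℕ =>
                      (b : ZMod q₁) * ((n₁ : ZMod q₁) * (a₂ : ZMod q₁)) = (a₁ : ZMod q₁) ∧
                      (b : ZMod q₂) * ((n₂ : ZMod q₂) * (a₂ : ZMod q₂)) = (a₁ : ZMod q₂)),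
                    ∑ h ∈ Finset.Icc (-(⌈(3 * S) ^ 2 * x ^ ε₁ / M⌉₊ : ℤ)) ⌈(3 * S) ^ 2 * x ^ ε₁ / M⌉₊,
                      (if ((Nat.lcm q₁ q₂ : ℕ) : ℤ) ∣ h then 0 else
                        𝓕 (BFI.bumpC 1 (1 / 2)) (M * h / (Nat.lcm q₁ q₂ : ℕ)) *
                          (𝐞 ((b : ℝ) * h / (Nat.lcm q₁ q₂ : ℕ)) : ℂ)))‖ ≤
          C * M * N ^ 2 * x ^ (-3 * min κ (1 / 100)) := by
  -- `κ' = min κ (1/100)`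
  set κ' : ℝ := min κ (1 / 100) with hκ'def
  have hκ'0 : 0 < κ' := lt_min hκ (by norm_num)
  have hκ'κ : κ' ≤ κ := min_le_left _ _
  have hκ'1 : κ' ≤ 1 / 100 := min_le_right _ _
  obtain ⟨δ₁, hδ₁, Hδ⟩ := HR
  set δ : ℝ := min δ₁ (min (κ' / 4) (1 / 100)) with hδdef
  have hδ0 : 0 < δ := lt_min hδ₁ (lt_min (by positivity) (by norm_num))
  have hδ₁' : δ ≤ δ₁ := min_le_left _ _
  have hδκ : δ ≤ κ' / 4 := (min_le_right _ _).trans (min_le_left _ _)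
  have hδ1 : δ ≤ 1 / 100 := (min_le_right _ _).trans (min_le_right _ _)
  refine ⟨δ, hδ0, fun Aτ hAτ => ?_⟩
  obtain ⟨C₁, x₁, HC1⟩ := Hδ Aτ hAτ
  -- ### constants
  set ε : ℝ := κ' / 8 with hεdef
  have hε0 : 0 < ε := by positivity
  set ε' : ℝ := ε / (Aτ + 1) with hε'def
  have hε'0 : 0 < ε' := by positivity
  have hε'A : 2 * ε' * Aτ ≤ 2 * ε := by
    have h1 : ε' * (Aτ + 1) = ε := by rw [hε'def]; field_simp
    nlinarith [hε'0.le, hAτ]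
  obtain ⟨Cβ, hCβ1, hCβ⟩ := exists_sigma_zero_le_mul_rpow hε'0
  have hCβA : 1 ≤ Cβ ^ Aτ := Real.one_le_rpow hCβ1 hAτ
  set Iψ : ℝ := ∫ t, ‖BFI.bumpC 1 (1 / 2) t‖ with hIψdef
  have hIψ0 : 0 ≤ Iψ := integral_nonneg fun _ => norm_nonneg _
  have hIψ2 : Iψ ≤ 2 := integral_norm_bumpC_one_half_le
  -- thresholds
  obtain ⟨x₂, hx₂⟩ := exists_mul_log_pow_le_rpow (4000000 * (Cβ ^ Aτ) ^ 2) 0 (κ := 2 / 5) (by norm_num)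
  obtain ⟨x₃, hx₃⟩ := exists_mul_log_pow_le_rpow 9 0 (κ := κ' / 2) (by positivity)
  refine ⟨max C₁ 0 + 1, max (max x₁ 9) (max x₂ x₃), fun x hx M N S Rd Y hMN hN hNS hS hSx hRd1 hRd
    hY1 hY4 a₁ a₂ ha₁ ha₂ ha₁x ha₂x β hβ hβs q₀ n₀ hq₀ hq₀x hn₀ hn₀x hcop hcq₀ hcn₀ => ?_⟩
  -- ### sizes
  have hxx₁ : x₁ ≤ x := le_trans (le_trans (le_max_left _ _) (le_max_left _ _)) hx
  have hx9 : 9 ≤ x := le_trans (le_trans (le_max_right _ _) (le_max_left _ _)) hx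
  have hxx₂ : x₂ ≤ x := le_trans (le_trans (le_max_left _ _) (le_max_right _ _)) hx
  have hxx₃ : x₃ ≤ x := le_trans (le_trans (le_max_right _ _) (le_max_right _ _)) hx
  have hx1 : 1 ≤ x := by linarith
  have hx0 : 0 < x := by linarith
  have hN0 : 0 < N := lt_of_lt_of_le (Real.rpow_pos_of_pos hx0 η) hN
  have hM0 : 0 < M := by
    by_contra h
    have : M * N ≤ 0 := mul_nonpos_of_nonpos_of_nonneg (not_lt.1 h) hN0.le
    linarith
  have hS0 : 0 < S := lt_of_lt_of_le (Real.rpow_pos_of_pos hx0 _) hS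
  have hS1 : 1 ≤ S := le_trans (Real.one_le_rpow hx1 (by norm_num)) hS
  have hY0 : 0 < Y := lt_of_lt_of_le (mul_pos hS0 (Real.rpow_pos_of_pos hx0 _)) hY1
  have hmono : ∀ {u v : ℝ}, u ≤ v → x ^ u ≤ x ^ v := fun h => Real.rpow_le_rpow_of_exponent_le hx1 h
  have hle1 : ∀ {u : ℝ}, u ≤ 1 → x ^ u ≤ x := fun h => (hmono h).trans_eq (Real.rpow_one x)
  have hN1 : 1 ≤ N := le_trans (Real.one_le_rpow hx1 hη.le) hN
  have hNS23 : N ≤ S ^ (2 / 3 : ℝ) :=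
    hNS.trans (Real.rpow_le_rpow_of_exponent_le hS1 (by linarith))
  have hNx34 : N ≤ x ^ (17 / 50 : ℝ) := by
    refine hNS23.trans ?_
    calc S ^ (2 / 3 : ℝ) ≤ (x ^ (1 / 2 + δ)) ^ (2 / 3 : ℝ) := Real.rpow_le_rpow hS0.le hSx (by norm_num)
      _ = x ^ ((1 / 2 + δ) * (2 / 3)) := by rw [← Real.rpow_mul hx0.le]
      _ ≤ x ^ (17 / 50 : ℝ) := hmono (by linarith)
  have hNx : N ≤ x := hNx34.trans (hle1 (by norm_num))
  have hMeq : M = x / N := by field_simp; linarith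
  have hMbig : x ^ (33 / 50 : ℝ) ≤ M := by
    rw [hMeq, le_div_iff₀ hN0]
    calc x ^ (33 / 50 : ℝ) * N ≤ x ^ (33 / 50 : ℝ) * x ^ (17 / 50 : ℝ) :=
          mul_le_mul_of_nonneg_left hNx34 (by positivity)
      _ = x := by rw [← Real.rpow_add hx0]; norm_num
  have hxM : x * x ^ (33 / 50 : ℝ) ≤ x * M := mul_le_mul_of_nonneg_left hMbig hx0.le
  have hS2 : S ^ 2 ≤ x ^ (1 + 2 * δ) := by
    calc S ^ 2 ≤ (x ^ (1 / 2 + δ)) ^ 2 := pow_le_pow_left₀ hS0.le hSx 2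
      _ = x ^ (1 + 2 * δ) := by rw [← Real.rpow_natCast, ← Real.rpow_mul hx0.le]; ring_nf
  have hS2' : x ^ (1 / 2 : ℝ) ≤ S ^ 2 := by
    calc x ^ (1 / 2 : ℝ) = (x ^ (1 / 4 : ℝ)) ^ 2 := by
          rw [← Real.rpow_natCast, ← Real.rpow_mul hx0.le]; norm_num
      _ ≤ S ^ 2 := pow_le_pow_left₀ (by positivity) hS 2
  -- pointwise bound for `β`
  set Bi : ℝ := Cβ ^ Aτ * x ^ (2 * ε) with hBidef
  have hBi1 : 1 ≤ Bi := one_le_mul_of_one_le_of_one_le hCβA (Real.one_le_rpow hx1 (by positivity))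
  have hBi0 : 0 ≤ Bi := zero_le_one.trans hBi1
  have hn𝒩 : ∀ n ∈ (BFI.dyadic N).filter (fun n : ℕ => IsCoprime (n : ℤ) a₂),
      N < n ∧ (n : ℝ) ≤ 2 * N := by
    intro n hn
    exact (BFI.mem_dyadic hN0.le).1 (Finset.mem_filter.1 hn).1
  have hβBi : ∀ n ∈ (BFI.dyadic N).filter (fun n : ℕ => IsCoprime (n : ℤ) a₂), ‖β n‖ ≤ Bi := by
    intro n hn
    obtain ⟨hn1, hn2⟩ := hn𝒩 n hn
    have hnx2 : (n : ℝ) ≤ x ^ (2 : ℝ) := by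
      rw [Real.rpow_two, sq]
      calc (n : ℝ) ≤ 2 * N := hn2
        _ ≤ 2 * x := by linarith only [hNx]
        _ ≤ x * x := by
            have : 0 ≤ (x - 2) * x := mul_nonneg (by linarith only [hx9]) hx0.le
            linarith only [this]
    have h1 : (σ 0 n : ℝ) ≤ Cβ * (x ^ (2 : ℝ)) ^ ε' :=
      (hCβ n).trans (mul_le_mul_of_nonneg_left
        (Real.rpow_le_rpow (Nat.cast_nonneg n) hnx2 hε'0.le) (zero_le_one.trans hCβ1))
    have h2 : ((σ 0 n : ℝ)) ^ Aτ ≤ (Cβ * (x ^ (2 : ℝ)) ^ ε') ^ Aτ :=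
      Real.rpow_le_rpow (Nat.cast_nonneg _) h1 hAτ
    calc ‖β n‖ ≤ (σ 0 n : ℝ) ^ Aτ := hβ n
      _ ≤ (Cβ * (x ^ (2 : ℝ)) ^ ε') ^ Aτ := h2
      _ = Cβ ^ Aτ * x ^ (2 * ε' * Aτ) := by
          rw [Real.mul_rpow (zero_le_one.trans hCβ1) (by positivity), ← Real.rpow_mul hx0.le,
            ← Real.rpow_mul hx0.le]
      _ ≤ Bi := mul_le_mul_of_nonneg_left (hmono hε'A) (zero_le_one.trans hCβA)
  have hBi2 : Bi ^ 2 ≤ (Cβ ^ Aτ) ^ 2 * x ^ (κ' / 2) := by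
    rw [hBidef, mul_pow]
    refine mul_le_mul_of_nonneg_left ?_ (by positivity)
    rw [← Real.rpow_natCast, ← Real.rpow_mul hx0.le]
    exact hmono (by rw [hεdef]; norm_num; linarith)
  -- ### the objects
  set H : ℕ := ⌈(3 * S) ^ 2 * x ^ ε₁ / M⌉₊ with hHdef
  have hHpos : 0 < (3 * S) ^ 2 * x ^ ε₁ / M := by positivity
  have hHle : (H : ℝ) ≤ (3 * S) ^ 2 * x ^ ε₁ / M + 1 := (Nat.ceil_lt_add_one hHpos.le).le
  have hH0 : (0 : ℝ) ≤ H := Nat.cast_nonneg _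
  set A : Finset ℕ := ((((BFI.mRange S Y).filter (fun q : ℕ => 0 < q)).filter
              (fun q : ℕ => IsCoprime (q : ℤ) (a₁ * a₂))).filter (fun q : ℕ => q₀ ∣ q)).image (fun q : ℕ => q / q₀) with hAdef
  set B : Finset ℕ := (((BFI.dyadic N).filter (fun n : ℕ => IsCoprime (n : ℤ) a₂)).filter (fun n : ℕ => n₀ ∣ n)).image (fun n : ℕ => n / n₀) with hBdef
  have hq₀r : (0 : ℝ) < q₀ := by exact_mod_cast hq₀
  have hn₀r : (0 : ℝ) < n₀ := by exact_mod_cast hn₀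
  have hmemA : ∀ q ∈ A, q₀ * q ∈ ((BFI.mRange S Y).filter (fun q : ℕ => 0 < q)).filter
              (fun q : ℕ => IsCoprime (q : ℤ) (a₁ * a₂)) :=
    fun q hq => (mem_image_div_iff hq₀).1 hq
  have hmemB : ∀ n ∈ B, n₀ * n ∈ (BFI.dyadic N).filter (fun n : ℕ => IsCoprime (n : ℤ) a₂) :=
    fun n hn => (mem_image_div_iff hn₀).1 hn
  have hA : ∀ q ∈ A, 0 < q ∧ IsCoprime (((q₀ * q : ℕ)) : ℤ) (a₁ * a₂) := by
    intro q hq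
    have h := hmemA q hq
    rw [Finset.mem_filter, Finset.mem_filter] at h
    refine ⟨Nat.pos_of_ne_zero ?_, h.2⟩
    rintro rfl
    exact (lt_irrefl 0) (by simpa using h.1.2)
  have hB : ∀ n ∈ B, 0 < n ∧ IsCoprime (((n₀ * n : ℕ)) : ℤ) a₂ := by
    intro n hn
    have h := hmemB n hn
    have h' := hn𝒩 _ h
    refine ⟨Nat.pos_of_ne_zero ?_, (Finset.mem_filter.1 h).2⟩
    rintro rfl
    simp at h'
    linarith [h'.1]
  have hA0 : ∀ q ∈ A, 0 < q := fun q hq => (hA q hq).1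
  -- cardinalities
  have hcardA : (A.card : ℝ) ≤ 3 * S := by
    have h1 : A.card ≤ (((BFI.mRange S Y).filter (fun q : ℕ => 0 < q)).filter
              (fun q : ℕ => IsCoprime (q : ℤ) (a₁ * a₂))).card :=
      Finset.card_image_le.trans (Finset.card_filter_le _ _)
    have h2 : (((BFI.mRange S Y).filter (fun q : ℕ => 0 < q)).filter
              (fun q : ℕ => IsCoprime (q : ℤ) (a₁ * a₂))) ⊆ Finset.Icc 1 ⌊2 * S + Y⌋₊ := by
      intro q hq
      rw [Finset.mem_filter, Finset.mem_filter, BFI.mem_mRange] at hq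
      rw [Finset.mem_Icc]; exact ⟨hq.1.2, hq.1.1⟩
    calc (A.card : ℝ) ≤ ((((BFI.mRange S Y).filter (fun q : ℕ => 0 < q)).filter
              (fun q : ℕ => IsCoprime (q : ℤ) (a₁ * a₂))).card : ℝ) := by exact_mod_cast h1
      _ ≤ ((Finset.Icc 1 ⌊2 * S + Y⌋₊).card : ℝ) := by exact_mod_cast Finset.card_le_card h2
      _ = ⌊2 * S + Y⌋₊ := by simp
      _ ≤ 2 * S + Y := Nat.floor_le (by linarith)
      _ ≤ 3 * S := by linarith
  have hcardB : (B.card : ℝ) ≤ 2 * N := by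
    have h1 : B.card ≤ ((BFI.dyadic N).filter (fun n : ℕ => IsCoprime (n : ℤ) a₂)).card :=
      Finset.card_image_le.trans (Finset.card_filter_le _ _)
    have h2 : ((BFI.dyadic N).filter (fun n : ℕ => IsCoprime (n : ℤ) a₂)) ⊆ Finset.Icc 1 ⌊2 * N⌋₊ := by
      intro n hn
      obtain ⟨h1, h2⟩ := hn𝒩 n hn
      rw [Finset.mem_Icc]
      refine ⟨?_, Nat.le_floor h2⟩
      have : (1 : ℝ) ≤ n := by linarith
      exact_mod_cast this
    calc (B.card : ℝ) ≤ (((BFI.dyadic N).filter (fun n : ℕ => IsCoprime (n : ℤ) a₂)).card : ℝ) := by exact_mod_cast h1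
      _ ≤ ((Finset.Icc 1 ⌊2 * N⌋₊).card : ℝ) := by exact_mod_cast Finset.card_le_card h2
      _ = ⌊2 * N⌋₊ := by simp
      _ ≤ 2 * N := Nat.floor_le (by linarith)
  -- ### Step 2: the Taylor error — uniform bound for its terms
  set T₀ : ℝ := Bi ^ 2 * ((16 * q₀ * M / (9 * S ^ 2)) *
    ((Iψ * (2 * Real.pi * (16 * (x ^ δ) * q₀ * n₀ / (9 * S ^ 2 * N)))) * ((2 * H + 1) * H))) with hT₀def
  have hT₀0 : 0 ≤ T₀ := by positivity
  -- size of the Taylor error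
  have hq₀κ : (q₀ : ℝ) ≤ x ^ κ' := hq₀x
  have hn₀κ : (n₀ : ℝ) ≤ x ^ κ' := hn₀x
  have hxδκ : x ^ δ ≤ x ^ κ' := hmono (by linarith)
  have hπ4 : Real.pi ≤ 4 := Real.pi_le_four
  have hHH : ((2 : ℝ) * H + 1) * H ≤ 3 * ((3 * S) ^ 2 * x ^ ε₁ / M + 1) ^ 2 := by
    have h1 : (H : ℝ) ≤ (3 * S) ^ 2 * x ^ ε₁ / M + 1 := hHle
    have h1' : (1 : ℝ) ≤ (3 * S) ^ 2 * x ^ ε₁ / M + 1 := by linarith [hHpos.le]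
    nlinarith only [h1, h1', hH0]
  have hx25 : 4000000 * (Cβ ^ Aτ) ^ 2 ≤ x ^ (2 / 5 : ℝ) := by
    have := hx₂ x hxx₂; rwa [pow_zero, mul_one] at this
  have hC2 : 0 ≤ (Cβ ^ Aτ) ^ 2 := by positivity
  have hTE' : (3 * S) ^ 2 * (2 * N) ^ 2 * T₀ ≤ 1 / 2 * M * N ^ 2 * x ^ (-3 * κ') := by
    -- `(3S)²(2N)² T₀ ≤ 5463 (Cβ^A)² x^{5κ'} M N ((9S²x^{ε₁}/M + 1)²) / S²`
    have step1 : (3 * S) ^ 2 * (2 * N) ^ 2 * T₀ ≤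
        5463 * ((Cβ ^ Aτ) ^ 2 * x ^ (κ' / 2)) * (x ^ κ') ^ 4 * M * N *
          ((3 * S) ^ 2 * x ^ ε₁ / M + 1) ^ 2 / S ^ 2 := by
      rw [hT₀def]
      have e : (3 * S) ^ 2 * (2 * N) ^ 2 * (Bi ^ 2 * ((16 * q₀ * M / (9 * S ^ 2)) *
          ((Iψ * (2 * Real.pi * (16 * (x ^ δ) * q₀ * n₀ / (9 * S ^ 2 * N)))) * ((2 * H + 1) * H)))) =
          (36 * 16 * 2 * 16 / 81) * Bi ^ 2 * (Iψ * Real.pi) * ((q₀ : ℝ) * q₀ * n₀ * x ^ δ) * M * N *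
            ((2 * H + 1) * H) / S ^ 2 := by
        field_simp
        ring
      rw [e]
      have hIπ : Iψ * Real.pi ≤ 2 * 4 := mul_le_mul hIψ2 hπ4 Real.pi_pos.le (by norm_num)
      have hqqna : (q₀ : ℝ) * q₀ * n₀ * x ^ δ ≤ (x ^ κ') ^ 4 := by
        have := mul_le_mul (mul_le_mul (mul_le_mul hq₀κ hq₀κ hq₀r.le (by positivity)) hn₀κ hn₀r.le
          (by positivity)) hxδκ (by positivity) (by positivity)
        calc (q₀ : ℝ) * q₀ * n₀ * x ^ δ ≤ x ^ κ' * x ^ κ' * x ^ κ' * x ^ κ' := this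
          _ = (x ^ κ') ^ 4 := by ring
      rw [div_le_div_iff_of_pos_right (by positivity)]
      have hM0' := hM0.le
      have hN0' := hN0.le
      have hsq0 : (0 : ℝ) ≤ ((3 * S) ^ 2 * x ^ ε₁ / M + 1) ^ 2 := sq_nonneg _
      calc (36 * 16 * 2 * 16 / 81) * Bi ^ 2 * (Iψ * Real.pi) * ((q₀ : ℝ) * q₀ * n₀ * x ^ δ) * M * N *
            ((2 * H + 1) * H)
          ≤ (36 * 16 * 2 * 16 / 81) * ((Cβ ^ Aτ) ^ 2 * x ^ (κ' / 2)) * (2 * 4) * (x ^ κ') ^ 4 * M * N *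
            (3 * ((3 * S) ^ 2 * x ^ ε₁ / M + 1) ^ 2) := by
            gcongr
        _ ≤ _ := by
            have hP : (0 : ℝ) ≤ ((Cβ ^ Aτ) ^ 2 * x ^ (κ' / 2)) * (x ^ κ') ^ 4 * M * N *
                ((3 * S) ^ 2 * x ^ ε₁ / M + 1) ^ 2 := by positivity
            nlinarith only [hP]
    refine step1.trans ?_
    -- `(9S²x^{ε₁}/M + 1)² ≤ 2 (81 S⁴ x^{2ε₁}/M² + 1)`
    have step2 : ((3 * S) ^ 2 * x ^ ε₁ / M + 1) ^ 2 ≤ 2 * (81 * (S ^ 2) ^ 2 * x ^ (2 * ε₁) / M ^ 2 + 1) := by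
      have e : (3 * S) ^ 2 * x ^ ε₁ / M = 9 * S ^ 2 * x ^ ε₁ / M := by ring
      rw [e]
      have h2 : (9 * S ^ 2 * x ^ ε₁ / M) ^ 2 = 81 * (S ^ 2) ^ 2 * x ^ (2 * ε₁) / M ^ 2 := by
        rw [div_pow, show (2 : ℝ) * ε₁ = ε₁ + ε₁ by ring, Real.rpow_add hx0]; ring
      nlinarith only [sq_nonneg (9 * S ^ 2 * x ^ ε₁ / M - 1), h2]
    have hxpow4 : (x ^ κ') ^ 4 = x ^ (4 * κ') := by
      rw [← Real.rpow_natCast, ← Real.rpow_mul hx0.le]; ring_nf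
    rw [hxpow4]
    -- two pieces
    have hK0 : (0 : ℝ) ≤ 5463 * ((Cβ ^ Aτ) ^ 2 * x ^ (κ' / 2)) * x ^ (4 * κ') * M * N := by positivity
    have piece1 : 5463 * ((Cβ ^ Aτ) ^ 2 * x ^ (κ' / 2)) * x ^ (4 * κ') * M * N *
        (2 * (81 * (S ^ 2) ^ 2 * x ^ (2 * ε₁) / M ^ 2)) / S ^ 2 ≤ 1 / 4 * M * N ^ 2 * x ^ (-3 * κ') := by
      -- `⟸ 3.6e6 (Cβ^A)² x^{9κ'/2 + 2ε₁ + 3κ'} S² ≤ x M`, from `S² ≤ x^{1+2δ}`, `x^{33/50} ≤ M`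
      have e : 5463 * ((Cβ ^ Aτ) ^ 2 * x ^ (κ' / 2)) * x ^ (4 * κ') * M * N *
          (2 * (81 * (S ^ 2) ^ 2 * x ^ (2 * ε₁) / M ^ 2)) / S ^ 2 =
          (885006 * (Cβ ^ Aτ) ^ 2) * (x ^ (κ' / 2) * x ^ (4 * κ') * x ^ (2 * ε₁)) * S ^ 2 * N / M := by
        field_simp
        ring
      rw [e, div_le_iff₀ hM0]
      have hexp : x ^ (κ' / 2) * x ^ (4 * κ') * x ^ (2 * ε₁) * x ^ (1 + 2 * δ) * x ^ (3 * κ') ≤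
          x ^ (6 / 5 : ℝ) := by
        rw [← Real.rpow_add hx0, ← Real.rpow_add hx0, ← Real.rpow_add hx0, ← Real.rpow_add hx0]
        exact hmono (by linarith)
      have hx65 : x ^ (2 / 5 : ℝ) * x ^ (6 / 5 : ℝ) ≤ x * x ^ (33 / 50 : ℝ) := by
        rw [← Real.rpow_add hx0, show (x : ℝ) * x ^ (33 / 50 : ℝ) = x ^ (1 : ℝ) * x ^ (33 / 50 : ℝ) by
          rw [Real.rpow_one], ← Real.rpow_add hx0]
        exact hmono (by norm_num)
      have hneg : x ^ (-3 * κ') * x ^ (3 * κ') = 1 := by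
        rw [← Real.rpow_add hx0]; norm_num
      -- multiply target by `x^{3κ'}`
      have h3κ0 : 0 < x ^ (3 * κ') := Real.rpow_pos_of_pos hx0 _
      rw [← mul_le_mul_iff_of_pos_right h3κ0]
      have eR : 1 / 4 * M * N ^ 2 * x ^ (-3 * κ') * M * x ^ (3 * κ') = 1 / 4 * (M * N) * M * N := by
        calc _ = 1 / 4 * (M * N) * M * N * (x ^ (-3 * κ') * x ^ (3 * κ')) := by ring
          _ = _ := by rw [hneg, mul_one]
      rw [eR, hMN]
      calc (885006 * (Cβ ^ Aτ) ^ 2) * (x ^ (κ' / 2) * x ^ (4 * κ') * x ^ (2 * ε₁)) * S ^ 2 * N * x ^ (3 * κ')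
          = (885006 * (Cβ ^ Aτ) ^ 2) * ((x ^ (κ' / 2) * x ^ (4 * κ') * x ^ (2 * ε₁)) * S ^ 2 * x ^ (3 * κ')) * N := by ring
        _ ≤ (1 / 4 * x ^ (2 / 5 : ℝ)) * (x ^ (6 / 5 : ℝ)) * N := by
            refine mul_le_mul_of_nonneg_right (mul_le_mul (by linarith only [hx25, hC2]) ?_ (by positivity)
              (by positivity)) hN0.le
            calc x ^ (κ' / 2) * x ^ (4 * κ') * x ^ (2 * ε₁) * S ^ 2 * x ^ (3 * κ')
                ≤ x ^ (κ' / 2) * x ^ (4 * κ') * x ^ (2 * ε₁) * x ^ (1 + 2 * δ) * x ^ (3 * κ') := by gcongr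
              _ ≤ x ^ (6 / 5 : ℝ) := hexp
        _ = 1 / 4 * (x ^ (2 / 5 : ℝ) * x ^ (6 / 5 : ℝ)) * N := by ring
        _ ≤ 1 / 4 * (x * x ^ (33 / 50 : ℝ)) * N := by gcongr
        _ ≤ 1 / 4 * (x * M) * N := by gcongr
        _ = 1 / 4 * x * M * N := by ring
    have piece2 : 5463 * ((Cβ ^ Aτ) ^ 2 * x ^ (κ' / 2)) * x ^ (4 * κ') * M * N * (2 * 1) / S ^ 2 ≤
        1 / 4 * M * N ^ 2 * x ^ (-3 * κ') := by
      rw [div_le_iff₀ (by positivity)]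
      have h3κ0 : 0 < x ^ (3 * κ') := Real.rpow_pos_of_pos hx0 _
      rw [← mul_le_mul_iff_of_pos_right h3κ0]
      have hneg : x ^ (-3 * κ') * x ^ (3 * κ') = 1 := by
        rw [← Real.rpow_add hx0]; norm_num
      have eR : 1 / 4 * M * N ^ 2 * x ^ (-3 * κ') * S ^ 2 * x ^ (3 * κ') = 1 / 4 * M * N ^ 2 * S ^ 2 := by
        calc _ = 1 / 4 * M * N ^ 2 * S ^ 2 * (x ^ (-3 * κ') * x ^ (3 * κ')) := by ring
          _ = _ := by rw [hneg, mul_one]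
      rw [eR]
      have hexp : x ^ (κ' / 2) * x ^ (4 * κ') * x ^ (3 * κ') ≤ x ^ (1 / 10 : ℝ) := by
        rw [← Real.rpow_add hx0, ← Real.rpow_add hx0]
        exact hmono (by linarith)
      have hx12 : x ^ (2 / 5 : ℝ) * x ^ (1 / 10 : ℝ) = x ^ (1 / 2 : ℝ) := by
        rw [← Real.rpow_add hx0]; norm_num
      calc 5463 * ((Cβ ^ Aτ) ^ 2 * x ^ (κ' / 2)) * x ^ (4 * κ') * M * N * (2 * 1) * x ^ (3 * κ')
          = (10926 * (Cβ ^ Aτ) ^ 2) * (x ^ (κ' / 2) * x ^ (4 * κ') * x ^ (3 * κ')) * M * N := by ring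
        _ ≤ (1 / 4 * x ^ (2 / 5 : ℝ)) * x ^ (1 / 10 : ℝ) * M * N :=
            mul_le_mul_of_nonneg_right (mul_le_mul_of_nonneg_right (mul_le_mul
              (by linarith only [hx25, hC2]) hexp (by positivity) (by positivity)) hM0.le) hN0.le
        _ = 1 / 4 * M * N * (x ^ (2 / 5 : ℝ) * x ^ (1 / 10 : ℝ)) := by ring
        _ ≤ 1 / 4 * M * N * S ^ 2 := by rw [hx12]; gcongr
        _ ≤ 1 / 4 * M * N ^ 2 * S ^ 2 := by
            have : M * N * S ^ 2 ≤ M * N ^ 2 * S ^ 2 := by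
              have : N ≤ N ^ 2 := by nlinarith only [hN1]
              gcongr
            linarith only [this]
    calc 5463 * ((Cβ ^ Aτ) ^ 2 * x ^ (κ' / 2)) * x ^ (4 * κ') * M * N *
          ((3 * S) ^ 2 * x ^ ε₁ / M + 1) ^ 2 / S ^ 2
        ≤ 5463 * ((Cβ ^ Aτ) ^ 2 * x ^ (κ' / 2)) * x ^ (4 * κ') * M * N *
          (2 * (81 * (S ^ 2) ^ 2 * x ^ (2 * ε₁) / M ^ 2 + 1)) / S ^ 2 := by gcongr
      _ = 5463 * ((Cβ ^ Aτ) ^ 2 * x ^ (κ' / 2)) * x ^ (4 * κ') * M * N *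
          (2 * (81 * (S ^ 2) ^ 2 * x ^ (2 * ε₁) / M ^ 2)) / S ^ 2 +
          5463 * ((Cβ ^ Aτ) ^ 2 * x ^ (κ' / 2)) * x ^ (4 * κ') * M * N * (2 * 1) / S ^ 2 := by ring
      _ ≤ 1 / 4 * M * N ^ 2 * x ^ (-3 * κ') + 1 / 4 * M * N ^ 2 * x ^ (-3 * κ') := add_le_add piece1 piece2
      _ = 1 / 2 * M * N ^ 2 * x ^ (-3 * κ') := by ring
  have hrange : ∀ q : ℕ, BFI.bump S Y ((q₀ * q : ℕ) : ℝ) ≠ 0 →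
      3 * S / 4 < ((q₀ * q : ℕ) : ℝ) ∧ ((q₀ * q : ℕ) : ℝ) < 9 * S / 4 := by
    intro q hq
    constructor
    · by_contra h
      exact hq (BFI.bump_eq_zero_of_le hY0 hS0.le (by linarith [not_lt.1 h]))
    · by_contra h
      exact hq (BFI.bump_eq_zero_of_ge hY0 hS0.le (by linarith [not_lt.1 h]))
  have hterm : ∀ q₁ ∈ A, ∀ q₂ ∈ A, BFI.bump S Y ((q₀ * q₁ : ℕ) : ℝ) ≠ 0 →
      BFI.bump S Y ((q₀ * q₂ : ℕ) : ℝ) ≠ 0 → ∀ n₁ ∈ B, ∀ n₂ ∈ B,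
      ‖(if (Nat.Coprime q₁ q₂ ∧ Nat.Coprime n₁ n₂) then (1 : ℂ) else 0)‖ *
            ‖β (n₀ * n₁) * starRingEnd ℂ (β (n₀ * n₂))‖ *
          (‖(M : ℂ) / (Nat.lcm (q₀ * q₁) (q₀ * q₂) : ℂ)‖ *
            (Iψ * (2 * Real.pi * |(a₁ : ℝ) / ((q₀ : ℝ) * q₁ * q₂ * a₂ * n₀ * n₁)|) *
              ∑ h ∈ Finset.Icc (-(H : ℤ)) H, |(h : ℝ)|)) ≤ T₀ := by
    intro q₁ hq₁ q₂ hq₂ hγ₁ hγ₂ n₁ hn₁ n₂ hn₂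
    by_cases hc : (Nat.Coprime q₁ q₂ ∧ Nat.Coprime n₁ n₂)
    swap
    · rw [if_neg hc, norm_zero, zero_mul, zero_mul]; exact hT₀0
    rw [if_pos hc, norm_one, one_mul]
    obtain ⟨hl₁, hu₁⟩ := hrange q₁ hγ₁
    obtain ⟨hl₂, hu₂⟩ := hrange q₂ hγ₂
    have hq₁r : (0 : ℝ) < q₁ := by exact_mod_cast hA0 q₁ hq₁
    have hq₂r : (0 : ℝ) < q₂ := by exact_mod_cast hA0 q₂ hq₂
    -- `W = q₀q₁q₂ > 9S²/(16q₀)`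
    have hW : Nat.lcm (q₀ * q₁) (q₀ * q₂) = q₀ * q₁ * q₂ := by
      rw [Nat.lcm_mul_left, hc.1.lcm_eq_mul, mul_assoc]
    have hWr : ((q₀ : ℝ) * q₁ * q₂) * q₀ = ((q₀ * q₁ : ℕ) : ℝ) * ((q₀ * q₂ : ℕ) : ℝ) := by
      push_cast; ring
    have hWl : (3 * S / 4) * (3 * S / 4) < ((q₀ : ℝ) * q₁ * q₂) * q₀ := by
      rw [hWr]; exact mul_lt_mul'' hl₁ hl₂ (by positivity) (by positivity)
    have hWpos : (0 : ℝ) < (q₀ : ℝ) * q₁ * q₂ := by positivity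
    have hinvW : 1 / ((q₀ : ℝ) * q₁ * q₂) ≤ 16 * q₀ / (9 * S ^ 2) := by
      rw [div_le_div_iff₀ hWpos (by positivity)]; linarith only [hWl]
    -- the factors
    have f1 : ‖β (n₀ * n₁) * starRingEnd ℂ (β (n₀ * n₂))‖ ≤ Bi ^ 2 := by
      rw [norm_mul, Complex.norm_conj, sq]
      exact mul_le_mul (hβBi _ (hmemB n₁ hn₁)) (hβBi _ (hmemB n₂ hn₂)) (norm_nonneg _) hBi0
    have f2 : ‖(M : ℂ) / (Nat.lcm (q₀ * q₁) (q₀ * q₂) : ℂ)‖ ≤ 16 * q₀ * M / (9 * S ^ 2) := by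
      rw [norm_div, Complex.norm_real, Real.norm_eq_abs, abs_of_pos hM0, hW]
      have e : ‖((q₀ * q₁ * q₂ : ℕ) : ℂ)‖ = (q₀ : ℝ) * q₁ * q₂ := by
        rw [Complex.norm_natCast]; push_cast; ring
      rw [e]
      calc M / ((q₀ : ℝ) * q₁ * q₂) = M * (1 / ((q₀ : ℝ) * q₁ * q₂)) := by ring
        _ ≤ M * (16 * q₀ / (9 * S ^ 2)) := mul_le_mul_of_nonneg_left hinvW hM0.le
        _ = 16 * q₀ * M / (9 * S ^ 2) := by ring
    have hNn₁ : N < ((n₀ * n₁ : ℕ) : ℝ) := (hn𝒩 _ (hmemB n₁ hn₁)).1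
    have hn₁r : (0 : ℝ) < n₁ := by exact_mod_cast (hB n₁ hn₁).1
    have ha₂r : (1 : ℝ) ≤ |(a₂ : ℝ)| := by
      rw [← Int.cast_abs]; exact_mod_cast Int.one_le_abs ha₂
    have f3 : |(a₁ : ℝ) / ((q₀ : ℝ) * q₁ * q₂ * a₂ * n₀ * n₁)| ≤
        16 * (x ^ δ) * q₀ * n₀ / (9 * S ^ 2 * N) := by
      rw [abs_div]
      have hden : ((q₀ : ℝ) * q₁ * q₂) * n₁ ≤ |(q₀ : ℝ) * q₁ * q₂ * a₂ * n₀ * n₁| := by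
        rw [show (q₀ : ℝ) * q₁ * q₂ * a₂ * n₀ * n₁ = ((q₀ : ℝ) * q₁ * q₂ * n₁) * (a₂ * n₀) by ring,
          abs_mul, abs_of_pos (by positivity : (0 : ℝ) < (q₀ : ℝ) * q₁ * q₂ * n₁), abs_mul,
          Nat.abs_cast]
        have : (1 : ℝ) ≤ |(a₂ : ℝ)| * n₀ := one_le_mul_of_one_le_of_one_le ha₂r (by exact_mod_cast hn₀)
        calc (q₀ : ℝ) * q₁ * q₂ * n₁ = ((q₀ : ℝ) * q₁ * q₂ * n₁) * 1 := (mul_one _).symm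
          _ ≤ ((q₀ : ℝ) * q₁ * q₂ * n₁) * (|(a₂ : ℝ)| * n₀) :=
              mul_le_mul_of_nonneg_left this (by positivity)
      have hden0 : (0 : ℝ) < ((q₀ : ℝ) * q₁ * q₂) * n₁ := by positivity
      calc |(a₁ : ℝ)| / |(q₀ : ℝ) * q₁ * q₂ * a₂ * n₀ * n₁|
          ≤ x ^ δ / (((q₀ : ℝ) * q₁ * q₂) * n₁) := by
            rw [← Int.cast_abs] at ha₁x ⊢
            exact div_le_div₀ (by positivity) ha₁x hden0 hden
        _ = x ^ δ * (1 / ((q₀ : ℝ) * q₁ * q₂)) * (1 / n₁) := by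
            field_simp
        _ ≤ x ^ δ * (16 * q₀ / (9 * S ^ 2)) * (n₀ / N) := by
            refine mul_le_mul (mul_le_mul_of_nonneg_left hinvW (by positivity)) ?_ (by positivity)
              (by positivity)
            rw [div_le_div_iff₀ hn₁r hN0, one_mul]
            push_cast at hNn₁
            linarith only [hNn₁]
        _ = 16 * (x ^ δ) * q₀ * n₀ / (9 * S ^ 2 * N) := by
            field_simp
    have f4 : ∑ h ∈ Finset.Icc (-(H : ℤ)) H, |(h : ℝ)| ≤ (2 * H + 1) * H := sum_Icc_abs_le H
    have f30 : 0 ≤ |(a₁ : ℝ) / ((q₀ : ℝ) * q₁ * q₂ * a₂ * n₀ * n₁)| := abs_nonneg _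
    have f40 : 0 ≤ ∑ h ∈ Finset.Icc (-(H : ℤ)) H, |(h : ℝ)| := Finset.sum_nonneg fun _ _ => abs_nonneg _
    rw [hT₀def]
    refine mul_le_mul f1 (mul_le_mul f2 (mul_le_mul (mul_le_mul_of_nonneg_left
      (mul_le_mul_of_nonneg_left f3 (by positivity)) hIψ0) f4 f40 (by positivity)) (by positivity)
      (by positivity)) (by positivity) (by positivity)
  have hTE : ∑ q₁ ∈ A, ∑ q₂ ∈ A, ‖((BFI.bump S Y ((q₀ * q₁ : ℕ) : ℝ) : ℝ) : ℂ) * ((BFI.bump S Y ((q₀ * q₂ : ℕ) : ℝ) : ℝ) : ℂ)‖ *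
        ∑ n₁ ∈ B, ∑ n₂ ∈ B,
          ‖(if (Nat.Coprime q₁ q₂ ∧ Nat.Coprime n₁ n₂) then (1 : ℂ) else 0)‖ *
            ‖β (n₀ * n₁) * starRingEnd ℂ (β (n₀ * n₂))‖ *
          (‖(M : ℂ) / (Nat.lcm (q₀ * q₁) (q₀ * q₂) : ℂ)‖ *
            ((∫ t, ‖BFI.bumpC 1 (1 / 2) t‖) *
              (2 * Real.pi * |(a₁ : ℝ) / ((q₀ : ℝ) * q₁ * q₂ * a₂ * n₀ * n₁)|) *
              ∑ h ∈ Finset.Icc (-(H : ℤ)) H, |(h : ℝ)|)) ≤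
      (3 * S) ^ 2 * (2 * N) ^ 2 * T₀ := by
    calc _ ≤ ∑ q₁ ∈ A, ∑ q₂ ∈ A, (B.card : ℝ) ^ 2 * T₀ := by
          refine Finset.sum_le_sum fun q₁ hq₁ => Finset.sum_le_sum fun q₂ hq₂ => ?_
          have hin0 : 0 ≤ ∑ n₁ ∈ B, ∑ n₂ ∈ B,
              ‖(if (Nat.Coprime q₁ q₂ ∧ Nat.Coprime n₁ n₂) then (1 : ℂ) else 0)‖ *
                ‖β (n₀ * n₁) * starRingEnd ℂ (β (n₀ * n₂))‖ *
              (‖(M : ℂ) / (Nat.lcm (q₀ * q₁) (q₀ * q₂) : ℂ)‖ *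
                (Iψ * (2 * Real.pi * |(a₁ : ℝ) / ((q₀ : ℝ) * q₁ * q₂ * a₂ * n₀ * n₁)|) *
                  ∑ h ∈ Finset.Icc (-(H : ℤ)) H, |(h : ℝ)|)) := by
            refine Finset.sum_nonneg fun n₁ _ => Finset.sum_nonneg fun n₂ _ => ?_
            have : 0 ≤ ∑ h ∈ Finset.Icc (-(H : ℤ)) H, |(h : ℝ)| :=
              Finset.sum_nonneg fun _ _ => abs_nonneg _
            positivity
          have hBT : 0 ≤ (B.card : ℝ) ^ 2 * T₀ := mul_nonneg (pow_nonneg (Nat.cast_nonneg _) 2) hT₀0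
          by_cases hγ₁ : BFI.bump S Y ((q₀ * q₁ : ℕ) : ℝ) = 0
          · rw [hγ₁, Complex.ofReal_zero, zero_mul, norm_zero, zero_mul]; exact hBT
          by_cases hγ₂ : BFI.bump S Y ((q₀ * q₂ : ℕ) : ℝ) = 0
          · rw [hγ₂, Complex.ofReal_zero, mul_zero, norm_zero, zero_mul]; exact hBT
          have hγle : ‖((BFI.bump S Y ((q₀ * q₁ : ℕ) : ℝ) : ℝ) : ℂ) * ((BFI.bump S Y ((q₀ * q₂ : ℕ) : ℝ) : ℝ) : ℂ)‖ ≤ 1 := by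
            rw [norm_mul, Complex.norm_real, Complex.norm_real, Real.norm_eq_abs, Real.norm_eq_abs]
            exact mul_le_one₀ (BFI.abs_bump_le_one hY0 hS0.le _) (abs_nonneg _)
              (BFI.abs_bump_le_one hY0 hS0.le _)
          calc _ ≤ 1 * ∑ n₁ ∈ B, ∑ n₂ ∈ B, T₀ := by
                refine mul_le_mul hγle (Finset.sum_le_sum fun n₁ hn₁ => Finset.sum_le_sum
                  fun n₂ hn₂ => hterm q₁ hq₁ q₂ hq₂ hγ₁ hγ₂ n₁ hn₁ n₂ hn₂) hin0 zero_le_one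
            _ = (B.card : ℝ) ^ 2 * T₀ := by
                rw [Finset.sum_const, Finset.sum_const, smul_smul, nsmul_eq_mul]; push_cast; ring
      _ = (A.card : ℝ) ^ 2 * ((B.card : ℝ) ^ 2 * T₀) := by
          rw [Finset.sum_const, Finset.sum_const, smul_smul, nsmul_eq_mul]; push_cast; ring
      _ ≤ (3 * S) ^ 2 * ((2 * N) ^ 2 * T₀) := by
          refine mul_le_mul (pow_le_pow_left₀ (Nat.cast_nonneg _) hcardA 2)
            (mul_le_mul_of_nonneg_right (pow_le_pow_left₀ (Nat.cast_nonneg _) hcardB 2) hT₀0)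
            (mul_nonneg (pow_nonneg (Nat.cast_nonneg _) 2) hT₀0) (by positivity)
      _ = (3 * S) ^ 2 * (2 * N) ^ 2 * T₀ := (mul_assoc _ _ _).symm
  -- the bound from `HR1pp`
  have hSx' : S ≤ x ^ (1 / 2 + δ₁) := hSx.trans (hmono (by linarith only [hδ₁']))
  have hRd' : Rd ≤ x ^ δ₁ := hRd.trans (hmono hδ₁')
  have hY1' : S * x ^ (-δ₁) ≤ Y :=
    le_trans (mul_le_mul_of_nonneg_left (hmono (by linarith only [hδ₁'])) hS0.le) hY1
  have ha₁x' : (|a₁| : ℝ) ≤ x ^ δ₁ := ha₁x.trans (hmono hδ₁')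
  have ha₂x' : (|a₂| : ℝ) ≤ x ^ δ₁ := ha₂x.trans (hmono hδ₁')
  have hq₀x' : (q₀ : ℝ) ≤ x ^ κ := hq₀x.trans (hmono hκ'κ)
  have hn₀x' : (n₀ : ℝ) ≤ x ^ κ := hn₀x.trans (hmono hκ'κ)
  have HC := HC1 x hxx₁ M N S Rd Y hMN hN hNS hS hSx' hRd1 hRd' hY1' hY4 a₁ a₂ ha₁ ha₂ ha₁x' ha₂x'
    β hβ hβs q₀ n₀ hq₀ hq₀x' hn₀ hn₀x' hcop hcq₀ hcn₀
  set Bpp : ℝ := C₁ * N ^ 2 * S ^ 2 * x ^ (-7 * κ) with hBppdef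
  have hab : 8 * M * q₀ / (81 * S ^ 2) ≤ 40 * M * q₀ / (9 * S ^ 2) := by
    rw [div_le_div_iff₀ (by positivity) (by positivity)]
    have h0 : 0 ≤ M * q₀ * S ^ 2 := by positivity
    nlinarith only [h0]
  -- ### Step 4: sizes of the main term
  have hx3 : 9 ≤ x ^ (κ' / 2) := by have := hx₃ x hxx₃; rwa [pow_zero, mul_one] at this
  have hV : 1 / 2 * M * N ^ 2 * x ^ (-3 * κ') +
      ((a₂.natAbs * n₀ : ℕ) : ℝ) ^ 2 * Bpp * (40 * M * q₀ / (9 * S ^ 2) - 8 * M * q₀ / (81 * S ^ 2)) ≤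
      (max C₁ 0 + 1) * M * N ^ 2 * x ^ (-3 * κ') := by
    have hC₁ : C₁ ≤ max C₁ 0 := le_max_left _ _
    have hC0 : 0 ≤ max C₁ 0 := le_max_right _ _
    have hm : ((a₂.natAbs * n₀ : ℕ) : ℝ) ≤ x ^ δ * x ^ κ' := by
      push_cast
      rw [Nat.cast_natAbs, Int.cast_abs]
      exact mul_le_mul ha₂x hn₀κ hn₀r.le (by positivity)
    have hBpp : Bpp ≤ max C₁ 0 * N ^ 2 * S ^ 2 * x ^ (-7 * κ') := by
      rw [hBppdef]
      exact mul_le_mul (mul_le_mul_of_nonneg_right (mul_le_mul_of_nonneg_right hC₁ (by positivity))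
        (by positivity)) (hmono (by linarith only [hκ'κ])) (by positivity) (by positivity)
    have hlen : 40 * M * q₀ / (9 * S ^ 2) - 8 * M * q₀ / (81 * S ^ 2) ≤ 40 * M * x ^ κ' / (9 * S ^ 2) := by
      have h0 : 0 ≤ 8 * M * q₀ / (81 * S ^ 2) := by positivity
      have h1 : 40 * M * q₀ / (9 * S ^ 2) ≤ 40 * M * x ^ κ' / (9 * S ^ 2) := by gcongr
      linarith only [h0, h1]
    have hmain : ((a₂.natAbs * n₀ : ℕ) : ℝ) ^ 2 * Bpp *
        (40 * M * q₀ / (9 * S ^ 2) - 8 * M * q₀ / (81 * S ^ 2)) ≤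
        (x ^ δ * x ^ κ') ^ 2 * (max C₁ 0 * N ^ 2 * S ^ 2 * x ^ (-7 * κ')) *
          (40 * M * x ^ κ' / (9 * S ^ 2)) := by
      have hBpp0 : 0 ≤ Bpp := (norm_nonneg _).trans (HC 0 0 0)
      refine mul_le_mul (mul_le_mul (pow_le_pow_left₀ (Nat.cast_nonneg _) hm 2) hBpp hBpp0
        (by positivity)) hlen (by linarith only [hab]) (by positivity)
    refine le_trans (add_le_add le_rfl hmain) ?_
    -- `(x^δ x^κ')² S² x^{-7κ'} (40 M x^κ'/(9S²)) = (40/9) M x^{2δ+3κ'-7κ'} ≤ (1/2) M x^{-3κ'}`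
    have e : (x ^ δ * x ^ κ') ^ 2 * (max C₁ 0 * N ^ 2 * S ^ 2 * x ^ (-7 * κ')) *
        (40 * M * x ^ κ' / (9 * S ^ 2)) =
        (40 / 9) * max C₁ 0 * M * N ^ 2 * (x ^ (2 * δ + 3 * κ' + -7 * κ')) := by
      have e1 : x ^ (2 * δ + 3 * κ' + -7 * κ') = (x ^ δ * x ^ κ') ^ 2 * x ^ κ' * x ^ (-7 * κ') := by
        rw [Real.rpow_add hx0, Real.rpow_add hx0, mul_pow, ← Real.rpow_natCast, ← Real.rpow_natCast,
          ← Real.rpow_mul hx0.le, ← Real.rpow_mul hx0.le,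
          show (3 : ℝ) * κ' = κ' * ((2 : ℕ) : ℝ) + κ' by push_cast; ring, Real.rpow_add hx0]
        push_cast; ring
      rw [e1]; field_simp
    rw [e]
    have hexp : (40 / 9 : ℝ) * x ^ (2 * δ + 3 * κ' + -7 * κ') ≤ 1 / 2 * x ^ (-3 * κ') := by
      have h1 : x ^ (2 * δ + 3 * κ' + -7 * κ') * x ^ (κ' / 2) ≤ x ^ (-3 * κ') := by
        rw [← Real.rpow_add hx0]; exact hmono (by linarith only [hδκ])
      have h0 : 0 ≤ x ^ (2 * δ + 3 * κ' + -7 * κ') := by positivity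
      nlinarith only [h1, hx3, h0]
    have hMN2 : 0 ≤ max C₁ 0 * M * N ^ 2 := by positivity
    have hfin := mul_le_mul_of_nonneg_left hexp hMN2
    have hpos : (0 : ℝ) ≤ M * N ^ 2 * x ^ (-3 * κ') := by positivity
    have h1 := mul_nonneg hC0 hpos
    nlinarith only [hfin, hpos, h1]
  -- ### Step 3: the classes and the `ξ`-integral
  have hGcls := integrand_eq_sum_classes a₁ ha₂ A B q₀ hn₀ (fun q : ℕ => BFI.bump S Y q) β M H
  beta_reduce at hGcls
  have hGbd : ∀ ξ ∈ Set.Icc (8 * M * q₀ / (81 * S ^ 2)) (40 * M * q₀ / (9 * S ^ 2)),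
      ‖∑ q₁ ∈ A, ∑ q₂ ∈ A, ((BFI.bump S Y ((q₀ * q₁ : ℕ) : ℝ) : ℝ) : ℂ) * ((BFI.bump S Y ((q₀ * q₂ : ℕ) : ℝ) : ℝ) : ℂ) *
        ∑ n₁ ∈ B, ∑ n₂ ∈ B,
          (if (Nat.Coprime q₁ q₂ ∧ Nat.Coprime n₁ n₂) then (1 : ℂ) else 0) *
            (β (n₀ * n₁) * starRingEnd ℂ (β (n₀ * n₂))) *
          (if ((n₀ * n₁).Coprime (q₀ * q₁) ∧ (n₀ * n₂).Coprime (q₀ * q₂) ∧ n₁ ≡ n₂ [MOD q₀]) then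
              ∑ h ∈ Finset.Icc (-(H : ℤ)) H,
                (if ((Nat.lcm (q₀ * q₁) (q₀ * q₂) : ℕ) : ℤ) ∣ h then 0 else
                  (𝐞 (-(ξ * h)) : ℂ) * BFI.bumpC 1 (1 / 2) ((Nat.lcm (q₀ * q₁) (q₀ * q₂) : ℕ) * ξ / M) *
                    ((𝐞 ((h : ℝ) * a₁ * ((((n₁ : ℤ) - n₂) / q₀ : ℤ)) *
                        ((((((q₁ : ℤ) * a₂ * n₀ * n₂ : ℤ) : ZMod (n₁ * q₂))⁻¹).val : ℕ) : ℝ) /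
                          ((n₁ : ℝ) * q₂)) : ℂ) *
                      (𝐞 (-((h : ℝ) * a₁ *
                        ((((((q₀ : ℤ) * q₁ * q₂ * n₁ : ℤ) : ZMod (a₂.natAbs * n₀))⁻¹).val : ℕ) : ℝ) /
                          ((a₂ : ℝ) * n₀))) : ℂ)))
            else 0)‖ ≤ ((a₂.natAbs * n₀ : ℕ) : ℝ) ^ 2 * Bpp := by
    intro ξ _
    rw [hGcls ξ]
    exact norm_sum_range_sum_range_le fun l₁ _ l₂ _ => HC ξ l₁ l₂
  have hI := R1prime_eq_integral a₁ a₂ B n₀ hq₀ hA0 (fun q : ℕ => BFI.bump S Y q) β hM0 H (A := A)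
  have hGsupp := fun (ξ : ℝ) (hξ : ξ ∉ Set.Icc (8 * M * q₀ / (81 * S ^ 2)) (40 * M * q₀ / (9 * S ^ 2))) =>
    integrand_eq_zero_of_not_mem_Icc a₁ a₂ B n₀ hq₀ hA0 hS0 hY0 hY4 hM0 β H hξ (A := A)
  have hU := norm_integral_le_of_support_Icc hab hGsupp hGbd
  -- ### Step 1: reindexing and the phases (5.22); the Taylor estimate
  have e₀ := R1piece_eq_reindex a₁ a₂ (((BFI.mRange S Y).filter (fun q : ℕ => 0 < q)).filter
              (fun q : ℕ => IsCoprime (q : ℤ) (a₁ * a₂)))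
    ((BFI.dyadic N).filter (fun n : ℕ => IsCoprime (n : ℤ) a₂)) (fun q : ℕ => BFI.bump S Y q) β M H hq₀ hn₀
  have e₁ := R1piece_reindexed_eq_phase (a₁ := a₁) ha₂ hq₀ hn₀ hcop hA hB
    (fun q : ℕ => BFI.bump S Y q) hβs M H
  have hT := norm_R1piece_phase_sub_R1prime_le a₁ a₂ A B q₀ n₀ (fun q : ℕ => BFI.bump S Y q) β M H
  beta_reduce at hT
  -- ### combine
  exact combine_key e₀ e₁ hT (hTE.trans hTE') hI hU hV

/-- **§5.5: `ℛ₁(q₀,n₀)` from `ℛ₁''`** (uniform `ε₁, κ`; kept for the record — the paper's argument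
gives `ε₁, κ` depending on `η`, see `R1small_of_R1pp'`). [cite: Drappeau2017, §5.5, (5.23)] -/
theorem R1small_of_R1pp
    (HR1pp : ∃ ε₁ κ : ℝ, 0 < ε₁ ∧ ε₁ ≤ 1 / 25 ∧ 0 < κ ∧ ∀ η : ℝ, 0 < η → ∃ δ : ℝ, 0 < δ ∧
      ∀ Aτ : ℝ, 0 ≤ Aτ → ∃ C x₀ : ℝ, ∀ x : ℝ, x₀ ≤ x →
      ∀ M N S Rd Y : ℝ, M * N = x → x ^ η ≤ N → N ≤ S ^ (2 / 3 - η) → x ^ (1 / 4 : ℝ) ≤ S →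
        S ≤ x ^ (1 / 2 + δ) → 1 ≤ Rd → Rd ≤ x ^ δ → S * x ^ (-δ) ≤ Y → Y ≤ S / 4 →
      ∀ a₁ a₂ : ℤ, a₁ ≠ 0 → a₂ ≠ 0 → (|a₁| : ℝ) ≤ x ^ δ → (|a₂| : ℝ) ≤ x ^ δ →
      ∀ β : ℕ → ℂ, (∀ n, ‖β n‖ ≤ (σ 0 n : ℝ) ^ Aτ) → (∀ n, ¬Squarefree n → β n = 0) →
      ∀ q₀ n₀ : ℕ, 0 < q₀ → (q₀ : ℝ) ≤ x ^ κ → 0 < n₀ → (n₀ : ℝ) ≤ x ^ κ → Nat.Coprime q₀ n₀ →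
        IsCoprime (q₀ : ℤ) (a₁ * a₂) → IsCoprime (n₀ : ℤ) a₂ →
      ∀ ξ : ℝ, ∀ l₁ l₂ : ℕ,
        ‖∑ q₁ ∈ (((((BFI.mRange S Y).filter (fun q : ℕ => 0 < q)).filter
              (fun q : ℕ => IsCoprime (q : ℤ) (a₁ * a₂))).filter (fun q : ℕ => q₀ ∣ q)).image (fun q : ℕ => q / q₀)).filter (fun q : ℕ => q % (a₂.natAbs * n₀) = l₁),
          ∑ q₂ ∈ (((((BFI.mRange S Y).filter (fun q : ℕ => 0 < q)).filter
              (fun q : ℕ => IsCoprime (q : ℤ) (a₁ * a₂))).filter (fun q : ℕ => q₀ ∣ q)).image (fun q : ℕ => q / q₀)).filter (fun q : ℕ => q % (a₂.natAbs * n₀) = l₂),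
          ((BFI.bump S Y ((q₀ * q₁ : ℕ) : ℝ) : ℝ) : ℂ) * ((BFI.bump S Y ((q₀ * q₂ : ℕ) : ℝ) : ℝ) : ℂ) *
        ∑ n₁ ∈ (((BFI.dyadic N).filter (fun n : ℕ => IsCoprime (n : ℤ) a₂)).filter (fun n : ℕ => n₀ ∣ n)).image (fun n : ℕ => n / n₀),
          ∑ n₂ ∈ (((BFI.dyadic N).filter (fun n : ℕ => IsCoprime (n : ℤ) a₂)).filter (fun n : ℕ => n₀ ∣ n)).image (fun n : ℕ => n / n₀),
          (if (Nat.Coprime q₁ q₂ ∧ Nat.Coprime n₁ n₂) then (1 : ℂ) else 0) *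
            (β (n₀ * n₁) * starRingEnd ℂ (β (n₀ * n₂))) *
          (if ((n₀ * n₁).Coprime (q₀ * q₁) ∧ (n₀ * n₂).Coprime (q₀ * q₂) ∧ n₁ ≡ n₂ [MOD q₀]) then
              ∑ h ∈ Finset.Icc (-(⌈(3 * S) ^ 2 * x ^ ε₁ / M⌉₊ : ℤ)) ⌈(3 * S) ^ 2 * x ^ ε₁ / M⌉₊,
                (if ((Nat.lcm (q₀ * q₁) (q₀ * q₂) : ℕ) : ℤ) ∣ h then 0 else
                  (𝐞 (-(ξ * h)) : ℂ) * BFI.bumpC 1 (1 / 2) ((Nat.lcm (q₀ * q₁) (q₀ * q₂) : ℕ) * ξ / M) *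
                    ((𝐞 ((h : ℝ) * a₁ * ((((n₁ : ℤ) - n₂) / q₀ : ℤ)) *
                        ((((((q₁ : ℤ) * a₂ * n₀ * n₂ : ℤ) : ZMod (n₁ * q₂))⁻¹).val : ℕ) : ℝ) /
                          ((n₁ : ℝ) * q₂)) : ℂ) *
                      (𝐞 (-((h : ℝ) * a₁ *
                        ((((((q₀ : ℤ) * l₁ * l₂ * n₁ : ℤ) : ZMod (a₂.natAbs * n₀))⁻¹).val : ℕ) : ℝ) /
                          ((a₂ : ℝ) * n₀))) : ℂ)))
            else 0)‖ ≤
          C * N ^ 2 * S ^ 2 * x ^ (-7 * κ)) :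
    ∃ ε₁ κ : ℝ, 0 < ε₁ ∧ 0 < κ ∧ ∀ η : ℝ, 0 < η → ∃ δ : ℝ, 0 < δ ∧ ∀ Aτ : ℝ, 0 ≤ Aτ →
      ∃ C x₀ : ℝ, ∀ x : ℝ, x₀ ≤ x →
      ∀ M N S Rd Y : ℝ, M * N = x → x ^ η ≤ N → N ≤ S ^ (2 / 3 - η) → x ^ (1 / 4 : ℝ) ≤ S →
        S ≤ x ^ (1 / 2 + δ) → 1 ≤ Rd → Rd ≤ x ^ δ → S * x ^ (-δ) ≤ Y → Y ≤ S / 4 →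
      ∀ a₁ a₂ : ℤ, a₁ ≠ 0 → a₂ ≠ 0 → (|a₁| : ℝ) ≤ x ^ δ → (|a₂| : ℝ) ≤ x ^ δ →
      ∀ β : ℕ → ℂ, (∀ n, ‖β n‖ ≤ (σ 0 n : ℝ) ^ Aτ) → (∀ n, ¬Squarefree n → β n = 0) →
      ∀ q₀ n₀ : ℕ, 0 < q₀ → (q₀ : ℝ) ≤ x ^ κ → 0 < n₀ → (n₀ : ℝ) ≤ x ^ κ → Nat.Coprime q₀ n₀ →
        IsCoprime (q₀ : ℤ) (a₁ * a₂) → IsCoprime (n₀ : ℤ) a₂ →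
        ‖∑ q₁ ∈ ((BFI.mRange S Y).filter (fun q : ℕ => 0 < q)).filter
              (fun q : ℕ => IsCoprime (q : ℤ) (a₁ * a₂)),
          ∑ q₂ ∈ ((BFI.mRange S Y).filter (fun q : ℕ => 0 < q)).filter
              (fun q : ℕ => IsCoprime (q : ℤ) (a₁ * a₂)),
            ((BFI.bump S Y q₁ : ℝ) : ℂ) * ((BFI.bump S Y q₂ : ℝ) : ℂ) *
            ∑ n₁ ∈ (BFI.dyadic N).filter (fun n : ℕ => IsCoprime (n : ℤ) a₂),
              ∑ n₂ ∈ (BFI.dyadic N).filter (fun n : ℕ => IsCoprime (n : ℤ) a₂),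
                (if (Nat.gcd q₁ q₂ = q₀ ∧ Nat.gcd n₁ n₂ = n₀) then (1 : ℂ) else 0) *
                  (β n₁ * starRingEnd ℂ (β n₂)) *
                ((M : ℂ) / (Nat.lcm q₁ q₂ : ℂ) *
                  ∑ b ∈ (Finset.range (Nat.lcm q₁ q₂)).filter (fun b : ℕ =>
                      (b : ZMod q₁) * ((n₁ : ZMod q₁) * (a₂ : ZMod q₁)) = (a₁ : ZMod q₁) ∧
                      (b : ZMod q₂) * ((n₂ : ZMod q₂) * (a₂ : ZMod q₂)) = (a₁ : ZMod q₂)),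
                    ∑ h ∈ Finset.Icc (-(⌈(3 * S) ^ 2 * x ^ ε₁ / M⌉₊ : ℤ)) ⌈(3 * S) ^ 2 * x ^ ε₁ / M⌉₊,
                      (if ((Nat.lcm q₁ q₂ : ℕ) : ℤ) ∣ h then 0 else
                        𝓕 (BFI.bumpC 1 (1 / 2)) (M * h / (Nat.lcm q₁ q₂ : ℕ)) *
                          (𝐞 ((b : ℝ) * h / (Nat.lcm q₁ q₂ : ℕ)) : ℂ)))‖ ≤
          C * M * N ^ 2 * x ^ (-3 * κ) := by
  obtain ⟨ε₁, κ, hε₁, hε₁s, hκ, HR⟩ := HR1pp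
  exact ⟨ε₁, min κ (1 / 100), hε₁, lt_min hκ (by norm_num), fun η hη =>
    R1small_of_R1pp_core hε₁s hκ hη (HR η hη)⟩

/-- **§5.5: `ℛ₁(q₀,n₀)` from `ℛ₁''`, with the quantifier order the paper's argument delivers**: the
saving coming from Theorem 2.1 is `x^{−η/2+O(δ)}` (p. 21, "taking `δ` sufficiently small in terms of
`η`"), so `ε₁` (cut-off `H`), `κ` (good `q₀, n₀ ≤ x^κ`) and `δ` are chosen AFTER `η`.  If for every
`η > 0` there are `ε₁ ≤ 1/25`, `κ`, `δ > 0` with `|ℛ₁''(ξ,λ₁,λ₂)| ≤ C N²S² x^{−7κ}` for all `ξ` and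
all classes, then the hypothesis of `Drappeau2017_theorem51_of_R1small'` holds.
[cite: Drappeau2017, §5.5, (5.23)–(5.24)] -/
theorem R1small_of_R1pp'
    (HR1pp : ∀ η : ℝ, 0 < η → ∃ ε₁ κ δ : ℝ, 0 < ε₁ ∧ ε₁ ≤ 1 / 25 ∧ 0 < κ ∧ 0 < δ ∧
      ∀ Aτ : ℝ, 0 ≤ Aτ → ∃ C x₀ : ℝ, ∀ x : ℝ, x₀ ≤ x →
      ∀ M N S Rd Y : ℝ, M * N = x → x ^ η ≤ N → N ≤ S ^ (2 / 3 - η) → x ^ (1 / 4 : ℝ) ≤ S →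
        S ≤ x ^ (1 / 2 + δ) → 1 ≤ Rd → Rd ≤ x ^ δ → S * x ^ (-δ) ≤ Y → Y ≤ S / 4 →
      ∀ a₁ a₂ : ℤ, a₁ ≠ 0 → a₂ ≠ 0 → (|a₁| : ℝ) ≤ x ^ δ → (|a₂| : ℝ) ≤ x ^ δ →
      ∀ β : ℕ → ℂ, (∀ n, ‖β n‖ ≤ (σ 0 n : ℝ) ^ Aτ) → (∀ n, ¬Squarefree n → β n = 0) →
      ∀ q₀ n₀ : ℕ, 0 < q₀ → (q₀ : ℝ) ≤ x ^ κ → 0 < n₀ → (n₀ : ℝ) ≤ x ^ κ → Nat.Coprime q₀ n₀ →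
        IsCoprime (q₀ : ℤ) (a₁ * a₂) → IsCoprime (n₀ : ℤ) a₂ →
      ∀ ξ : ℝ, ∀ l₁ l₂ : ℕ,
        ‖∑ q₁ ∈ (((((BFI.mRange S Y).filter (fun q : ℕ => 0 < q)).filter
              (fun q : ℕ => IsCoprime (q : ℤ) (a₁ * a₂))).filter (fun q : ℕ => q₀ ∣ q)).image (fun q : ℕ => q / q₀)).filter (fun q : ℕ => q % (a₂.natAbs * n₀) = l₁),
          ∑ q₂ ∈ (((((BFI.mRange S Y).filter (fun q : ℕ => 0 < q)).filter
              (fun q : ℕ => IsCoprime (q : ℤ) (a₁ * a₂))).filter (fun q : ℕ => q₀ ∣ q)).image (fun q : ℕ => q / q₀)).filter (fun q : ℕ => q % (a₂.natAbs * n₀) = l₂),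
          ((BFI.bump S Y ((q₀ * q₁ : ℕ) : ℝ) : ℝ) : ℂ) * ((BFI.bump S Y ((q₀ * q₂ : ℕ) : ℝ) : ℝ) : ℂ) *
        ∑ n₁ ∈ (((BFI.dyadic N).filter (fun n : ℕ => IsCoprime (n : ℤ) a₂)).filter (fun n : ℕ => n₀ ∣ n)).image (fun n : ℕ => n / n₀),
          ∑ n₂ ∈ (((BFI.dyadic N).filter (fun n : ℕ => IsCoprime (n : ℤ) a₂)).filter (fun n : ℕ => n₀ ∣ n)).image (fun n : ℕ => n / n₀),
          (if (Nat.Coprime q₁ q₂ ∧ Nat.Coprime n₁ n₂) then (1 : ℂ) else 0) *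
            (β (n₀ * n₁) * starRingEnd ℂ (β (n₀ * n₂))) *
          (if ((n₀ * n₁).Coprime (q₀ * q₁) ∧ (n₀ * n₂).Coprime (q₀ * q₂) ∧ n₁ ≡ n₂ [MOD q₀]) then
              ∑ h ∈ Finset.Icc (-(⌈(3 * S) ^ 2 * x ^ ε₁ / M⌉₊ : ℤ)) ⌈(3 * S) ^ 2 * x ^ ε₁ / M⌉₊,
                (if ((Nat.lcm (q₀ * q₁) (q₀ * q₂) : ℕ) : ℤ) ∣ h then 0 else
                  (𝐞 (-(ξ * h)) : ℂ) * BFI.bumpC 1 (1 / 2) ((Nat.lcm (q₀ * q₁) (q₀ * q₂) : ℕ) * ξ / M) *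
                    ((𝐞 ((h : ℝ) * a₁ * ((((n₁ : ℤ) - n₂) / q₀ : ℤ)) *
                        ((((((q₁ : ℤ) * a₂ * n₀ * n₂ : ℤ) : ZMod (n₁ * q₂))⁻¹).val : ℕ) : ℝ) /
                          ((n₁ : ℝ) * q₂)) : ℂ) *
                      (𝐞 (-((h : ℝ) * a₁ *
                        ((((((q₀ : ℤ) * l₁ * l₂ * n₁ : ℤ) : ZMod (a₂.natAbs * n₀))⁻¹).val : ℕ) : ℝ) /
                          ((a₂ : ℝ) * n₀))) : ℂ)))
            else 0)‖ ≤
          C * N ^ 2 * S ^ 2 * x ^ (-7 * κ)) :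
    ∀ η : ℝ, 0 < η → ∃ ε₁ κ δ : ℝ, 0 < ε₁ ∧ 0 < κ ∧ 0 < δ ∧ ∀ Aτ : ℝ, 0 ≤ Aτ →
      ∃ C x₀ : ℝ, ∀ x : ℝ, x₀ ≤ x →
      ∀ M N S Rd Y : ℝ, M * N = x → x ^ η ≤ N → N ≤ S ^ (2 / 3 - η) → x ^ (1 / 4 : ℝ) ≤ S →
        S ≤ x ^ (1 / 2 + δ) → 1 ≤ Rd → Rd ≤ x ^ δ → S * x ^ (-δ) ≤ Y → Y ≤ S / 4 →
      ∀ a₁ a₂ : ℤ, a₁ ≠ 0 → a₂ ≠ 0 → (|a₁| : ℝ) ≤ x ^ δ → (|a₂| : ℝ) ≤ x ^ δ →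
      ∀ β : ℕ → ℂ, (∀ n, ‖β n‖ ≤ (σ 0 n : ℝ) ^ Aτ) → (∀ n, ¬Squarefree n → β n = 0) →
      ∀ q₀ n₀ : ℕ, 0 < q₀ → (q₀ : ℝ) ≤ x ^ κ → 0 < n₀ → (n₀ : ℝ) ≤ x ^ κ → Nat.Coprime q₀ n₀ →
        IsCoprime (q₀ : ℤ) (a₁ * a₂) → IsCoprime (n₀ : ℤ) a₂ →
        ‖∑ q₁ ∈ ((BFI.mRange S Y).filter (fun q : ℕ => 0 < q)).filter
              (fun q : ℕ => IsCoprime (q : ℤ) (a₁ * a₂)),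
          ∑ q₂ ∈ ((BFI.mRange S Y).filter (fun q : ℕ => 0 < q)).filter
              (fun q : ℕ => IsCoprime (q : ℤ) (a₁ * a₂)),
            ((BFI.bump S Y q₁ : ℝ) : ℂ) * ((BFI.bump S Y q₂ : ℝ) : ℂ) *
            ∑ n₁ ∈ (BFI.dyadic N).filter (fun n : ℕ => IsCoprime (n : ℤ) a₂),
              ∑ n₂ ∈ (BFI.dyadic N).filter (fun n : ℕ => IsCoprime (n : ℤ) a₂),
                (if (Nat.gcd q₁ q₂ = q₀ ∧ Nat.gcd n₁ n₂ = n₀) then (1 : ℂ) else 0) *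
                  (β n₁ * starRingEnd ℂ (β n₂)) *
                ((M : ℂ) / (Nat.lcm q₁ q₂ : ℂ) *
                  ∑ b ∈ (Finset.range (Nat.lcm q₁ q₂)).filter (fun b : ℕ =>
                      (b : ZMod q₁) * ((n₁ : ZMod q₁) * (a₂ : ZMod q₁)) = (a₁ : ZMod q₁) ∧
                      (b : ZMod q₂) * ((n₂ : ZMod q₂) * (a₂ : ZMod q₂)) = (a₁ : ZMod q₂)),
                    ∑ h ∈ Finset.Icc (-(⌈(3 * S) ^ 2 * x ^ ε₁ / M⌉₊ : ℤ)) ⌈(3 * S) ^ 2 * x ^ ε₁ / M⌉₊,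
                      (if ((Nat.lcm q₁ q₂ : ℕ) : ℤ) ∣ h then 0 else
                        𝓕 (BFI.bumpC 1 (1 / 2)) (M * h / (Nat.lcm q₁ q₂ : ℕ)) *
                          (𝐞 ((b : ℝ) * h / (Nat.lcm q₁ q₂ : ℕ)) : ℂ)))‖ ≤
          C * M * N ^ 2 * x ^ (-3 * κ) := by
  intro η hη
  obtain ⟨ε₁, κ, δ₁, hε₁, hε₁s, hκ, hδ₁, H⟩ := HR1pp η hη
  obtain ⟨δ, hδ, H'⟩ := R1small_of_R1pp_core hε₁s hκ hη ⟨δ₁, hδ₁, H⟩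
  exact ⟨ε₁, min κ (1 / 100), δ, hε₁, lt_min hκ (by norm_num), hδ, H'⟩

/-- **Theorem 5.1 from the quintilinear bound (5.23)–(5.24).**  Composition of `R1small_of_R1pp`
with `Drappeau2017_theorem51_of_R1small`: Theorem 5.1 follows from the bound
`|ℛ₁''(ξ,λ₁,λ₂)| ≤ C N²S² x^{−7κ}` for the quintilinear sums of Kloosterman fractions `ℛ₁''` of
(5.23) — which is exactly what Theorem 2.1 of the paper supplies in (5.24).
[cite: Drappeau2017, §5.5, (5.23)–(5.24)] -/
theorem _root_.Literature.NumberTheory.Sieve.Drappeau2017_theorem51_of_R1pp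
    (HR1pp : ∃ ε₁ κ : ℝ, 0 < ε₁ ∧ ε₁ ≤ 1 / 25 ∧ 0 < κ ∧ ∀ η : ℝ, 0 < η → ∃ δ : ℝ, 0 < δ ∧
      ∀ Aτ : ℝ, 0 ≤ Aτ → ∃ C x₀ : ℝ, ∀ x : ℝ, x₀ ≤ x →
      ∀ M N S Rd Y : ℝ, M * N = x → x ^ η ≤ N → N ≤ S ^ (2 / 3 - η) → x ^ (1 / 4 : ℝ) ≤ S →
        S ≤ x ^ (1 / 2 + δ) → 1 ≤ Rd → Rd ≤ x ^ δ → S * x ^ (-δ) ≤ Y → Y ≤ S / 4 →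
      ∀ a₁ a₂ : ℤ, a₁ ≠ 0 → a₂ ≠ 0 → (|a₁| : ℝ) ≤ x ^ δ → (|a₂| : ℝ) ≤ x ^ δ →
      ∀ β : ℕ → ℂ, (∀ n, ‖β n‖ ≤ (σ 0 n : ℝ) ^ Aτ) → (∀ n, ¬Squarefree n → β n = 0) →
      ∀ q₀ n₀ : ℕ, 0 < q₀ → (q₀ : ℝ) ≤ x ^ κ → 0 < n₀ → (n₀ : ℝ) ≤ x ^ κ → Nat.Coprime q₀ n₀ →
        IsCoprime (q₀ : ℤ) (a₁ * a₂) → IsCoprime (n₀ : ℤ) a₂ →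
      ∀ ξ : ℝ, ∀ l₁ l₂ : ℕ,
        ‖∑ q₁ ∈ (((((BFI.mRange S Y).filter (fun q : ℕ => 0 < q)).filter
              (fun q : ℕ => IsCoprime (q : ℤ) (a₁ * a₂))).filter (fun q : ℕ => q₀ ∣ q)).image (fun q : ℕ => q / q₀)).filter (fun q : ℕ => q % (a₂.natAbs * n₀) = l₁),
          ∑ q₂ ∈ (((((BFI.mRange S Y).filter (fun q : ℕ => 0 < q)).filter
              (fun q : ℕ => IsCoprime (q : ℤ) (a₁ * a₂))).filter (fun q : ℕ => q₀ ∣ q)).image (fun q : ℕ => q / q₀)).filter (fun q : ℕ => q % (a₂.natAbs * n₀) = l₂),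
          ((BFI.bump S Y ((q₀ * q₁ : ℕ) : ℝ) : ℝ) : ℂ) * ((BFI.bump S Y ((q₀ * q₂ : ℕ) : ℝ) : ℝ) : ℂ) *
        ∑ n₁ ∈ (((BFI.dyadic N).filter (fun n : ℕ => IsCoprime (n : ℤ) a₂)).filter (fun n : ℕ => n₀ ∣ n)).image (fun n : ℕ => n / n₀),
          ∑ n₂ ∈ (((BFI.dyadic N).filter (fun n : ℕ => IsCoprime (n : ℤ) a₂)).filter (fun n : ℕ => n₀ ∣ n)).image (fun n : ℕ => n / n₀),
          (if (Nat.Coprime q₁ q₂ ∧ Nat.Coprime n₁ n₂) then (1 : ℂ) else 0) *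
            (β (n₀ * n₁) * starRingEnd ℂ (β (n₀ * n₂))) *
          (if ((n₀ * n₁).Coprime (q₀ * q₁) ∧ (n₀ * n₂).Coprime (q₀ * q₂) ∧ n₁ ≡ n₂ [MOD q₀]) then
              ∑ h ∈ Finset.Icc (-(⌈(3 * S) ^ 2 * x ^ ε₁ / M⌉₊ : ℤ)) ⌈(3 * S) ^ 2 * x ^ ε₁ / M⌉₊,
                (if ((Nat.lcm (q₀ * q₁) (q₀ * q₂) : ℕ) : ℤ) ∣ h then 0 else
                  (𝐞 (-(ξ * h)) : ℂ) * BFI.bumpC 1 (1 / 2) ((Nat.lcm (q₀ * q₁) (q₀ * q₂) : ℕ) * ξ / M) *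
                    ((𝐞 ((h : ℝ) * a₁ * ((((n₁ : ℤ) - n₂) / q₀ : ℤ)) *
                        ((((((q₁ : ℤ) * a₂ * n₀ * n₂ : ℤ) : ZMod (n₁ * q₂))⁻¹).val : ℕ) : ℝ) /
                          ((n₁ : ℝ) * q₂)) : ℂ) *
                      (𝐞 (-((h : ℝ) * a₁ *
                        ((((((q₀ : ℤ) * l₁ * l₂ * n₁ : ℤ) : ZMod (a₂.natAbs * n₀))⁻¹).val : ℕ) : ℝ) /
                          ((a₂ : ℝ) * n₀))) : ℂ)))
            else 0)‖ ≤
          C * N ^ 2 * S ^ 2 * x ^ (-7 * κ)) :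
    Drappeau2017_theorem51 :=
  Drappeau2017_theorem51_of_R1small (R1small_of_R1pp HR1pp)

/-- **Theorem 5.1 from the quintilinear bound (5.23)–(5.24)** — quantifier order as delivered by the
paper (`ε₁, κ, δ` depending on `η`); see `R1small_of_R1pp'`.  The remaining hypothesis is exactly
what Theorem 2.1 of the paper supplies in (5.24). [cite: Drappeau2017, §5.5, (5.23)–(5.24)] -/
theorem _root_.Literature.NumberTheory.Sieve.Drappeau2017_theorem51_of_R1pp'
    (HR1pp : ∀ η : ℝ, 0 < η → ∃ ε₁ κ δ : ℝ, 0 < ε₁ ∧ ε₁ ≤ 1 / 25 ∧ 0 < κ ∧ 0 < δ ∧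
      ∀ Aτ : ℝ, 0 ≤ Aτ → ∃ C x₀ : ℝ, ∀ x : ℝ, x₀ ≤ x →
      ∀ M N S Rd Y : ℝ, M * N = x → x ^ η ≤ N → N ≤ S ^ (2 / 3 - η) → x ^ (1 / 4 : ℝ) ≤ S →
        S ≤ x ^ (1 / 2 + δ) → 1 ≤ Rd → Rd ≤ x ^ δ → S * x ^ (-δ) ≤ Y → Y ≤ S / 4 →
      ∀ a₁ a₂ : ℤ, a₁ ≠ 0 → a₂ ≠ 0 → (|a₁| : ℝ) ≤ x ^ δ → (|a₂| : ℝ) ≤ x ^ δ →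
      ∀ β : ℕ → ℂ, (∀ n, ‖β n‖ ≤ (σ 0 n : ℝ) ^ Aτ) → (∀ n, ¬Squarefree n → β n = 0) →
      ∀ q₀ n₀ : ℕ, 0 < q₀ → (q₀ : ℝ) ≤ x ^ κ → 0 < n₀ → (n₀ : ℝ) ≤ x ^ κ → Nat.Coprime q₀ n₀ →
        IsCoprime (q₀ : ℤ) (a₁ * a₂) → IsCoprime (n₀ : ℤ) a₂ →
      ∀ ξ : ℝ, ∀ l₁ l₂ : ℕ,
        ‖∑ q₁ ∈ (((((BFI.mRange S Y).filter (fun q : ℕ => 0 < q)).filter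
              (fun q : ℕ => IsCoprime (q : ℤ) (a₁ * a₂))).filter (fun q : ℕ => q₀ ∣ q)).image (fun q : ℕ => q / q₀)).filter (fun q : ℕ => q % (a₂.natAbs * n₀) = l₁),
          ∑ q₂ ∈ (((((BFI.mRange S Y).filter (fun q : ℕ => 0 < q)).filter
              (fun q : ℕ => IsCoprime (q : ℤ) (a₁ * a₂))).filter (fun q : ℕ => q₀ ∣ q)).image (fun q : ℕ => q / q₀)).filter (fun q : ℕ => q % (a₂.natAbs * n₀) = l₂),
          ((BFI.bump S Y ((q₀ * q₁ : ℕ) : ℝ) : ℝ) : ℂ) * ((BFI.bump S Y ((q₀ * q₂ : ℕ) : ℝ) : ℝ) : ℂ) *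
        ∑ n₁ ∈ (((BFI.dyadic N).filter (fun n : ℕ => IsCoprime (n : ℤ) a₂)).filter (fun n : ℕ => n₀ ∣ n)).image (fun n : ℕ => n / n₀),
          ∑ n₂ ∈ (((BFI.dyadic N).filter (fun n : ℕ => IsCoprime (n : ℤ) a₂)).filter (fun n : ℕ => n₀ ∣ n)).image (fun n : ℕ => n / n₀),
          (if (Nat.Coprime q₁ q₂ ∧ Nat.Coprime n₁ n₂) then (1 : ℂ) else 0) *
            (β (n₀ * n₁) * starRingEnd ℂ (β (n₀ * n₂))) *
          (if ((n₀ * n₁).Coprime (q₀ * q₁) ∧ (n₀ * n₂).Coprime (q₀ * q₂) ∧ n₁ ≡ n₂ [MOD q₀]) then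
              ∑ h ∈ Finset.Icc (-(⌈(3 * S) ^ 2 * x ^ ε₁ / M⌉₊ : ℤ)) ⌈(3 * S) ^ 2 * x ^ ε₁ / M⌉₊,
                (if ((Nat.lcm (q₀ * q₁) (q₀ * q₂) : ℕ) : ℤ) ∣ h then 0 else
                  (𝐞 (-(ξ * h)) : ℂ) * BFI.bumpC 1 (1 / 2) ((Nat.lcm (q₀ * q₁) (q₀ * q₂) : ℕ) * ξ / M) *
                    ((𝐞 ((h : ℝ) * a₁ * ((((n₁ : ℤ) - n₂) / q₀ : ℤ)) *
                        ((((((q₁ : ℤ) * a₂ * n₀ * n₂ : ℤ) : ZMod (n₁ * q₂))⁻¹).val : ℕ) : ℝ) /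
                          ((n₁ : ℝ) * q₂)) : ℂ) *
                      (𝐞 (-((h : ℝ) * a₁ *
                        ((((((q₀ : ℤ) * l₁ * l₂ * n₁ : ℤ) : ZMod (a₂.natAbs * n₀))⁻¹).val : ℕ) : ℝ) /
                          ((a₂ : ℝ) * n₀))) : ℂ)))
            else 0)‖ ≤
          C * N ^ 2 * S ^ 2 * x ^ (-7 * κ)) :
    Drappeau2017_theorem51 :=
  Drappeau2017_theorem51_of_R1small' (R1small_of_R1pp' HR1pp)

end Drappeau2017

end Literature.NumberTheory.Sieve

end
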